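import Mathlib.LinearAlgebra.Lagrange
import Mathlib.Analysis.SpecificLimits.Normed
import Mathlib.Analysis.Normed.Group.Tannery
import Mathlib.Analysis.SpecialFunctions.Exp
import Mathlib.Analysis.SpecialFunctions.SmoothTransition
import Mathlib.Analysis.Calculus.ContDiff.Basic
import Mathlib.Analysis.Calculus.ContDiff.Bounds
import Mathlib.Analysis.Calculus.FDeriv.Extend
import Mathlib.Analysis.Calculus.TangentCone.Prod
import Mathlib.Analysis.Calculus.TangentCone.Real
import HarnessLib

/-!
# Seeley's extension theorem: `C^∞` functions on a half space extend across the boundary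

R. T. Seeley, *Extension of `C^∞` functions defined in a half space*, Proc. Amer. Math. Soc. 15
(1964), 625–626. **Theorem** (Seeley): there is a (continuous linear) extension operator
`E : D₊ → C^∞(ℝⁿ⁺¹)` with `E f = f` on `t ≥ 0`, where `D₊` consists of the functions `C^∞` on the
open half space all of whose derivatives have continuous limits at the boundary. It rests on the
**Lemma**: there are sequences `(a_k)`, `(b_k)` with (i) `b_k < 0`, (ii) `∑ |a_k| |b_k|ⁿ < ∞`,
(iii) `∑ a_k b_kⁿ = 1` for all `n`, (iv) `b_k → -∞`; then `E f (x, t) = ∑ a_k φ(b_k t) f(x, b_k t)`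
(`t < 0`) for a cutoff `φ`.

This file proves the theorem in the local form needed for manifolds with boundary (Mathlib's
`C^∞` maps of manifolds with boundary are `C^∞` *within* the closed model half space,
`ContDiffWithinAt`, and Mathlib has no extension theorem of Whitney/Seeley type): for a real normed
space `E'`, a complete normed space `F`, and `f : ℝ × E' → F` which is `C^∞` on a slab
`[0, δ) × B` (`B ⊆ E'` open) in the within sense, Seeley's extension `Literature.Seeley.extend δ f` is `C^∞`
on the open set `(-∞, δ) × B` (`Literature.Analysis.Calculus.Seeley.contDiffOn_extend`); consequently a function `C^∞` on
`U ∩ {t ≥ 0}` (`U` open) agrees near any boundary point with a `C^∞` function on a full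
neighbourhood (`Literature.Analysis.Calculus.Seeley.exists_contDiffOn_extension`). The topology on `D₊` and the
continuity/linearity of `E` are not formalised.

## The proof

* *Coefficients* (Seeley's Lemma, with `b_k = -2^k`): `a_k = A_k B_k` is the limit of the Lagrange
  coefficients `ℓ_N,k(-1) = ∏_{i ≤ N, i ≠ k} (1 + 2^i)/(2^i - 2^k)` (`Literature.Analysis.Calculus.Seeley.lag`), which satisfy
  `∑_{k ≤ N} ℓ_N,k(-1) (2^k)^j = (-1)^j` for `j ≤ N` exactly (Lagrange interpolation of `X^j` at
  the nodes `2^k`, evaluated at `-1`; Mathlib's `Lagrange.eq_interpolate`); the head `A_k` is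
  bounded by `4^k / 2^{k(k+1)/2}` and the tail `B_kN ↑ B_k ≤ e⁴` ("`log B_kN < 4`"), so that
  `∑_k |a_k| (2^k)^j < ∞` (ratio test) and `∑_k a_k (2^k)^j = (-1)^j` in the limit (Tannery's
  theorem), i.e. `∑_k a_k (-2^k)^j = 1` (`Literature.Analysis.Calculus.Seeley.tsum_coeff_mul_neg_pow`).
* *The operator* `E f (t, x) = ∑_k a_k φ(2^k t / δ) f(-2^k t, x)` for `t < 0` with a cutoff
  `φ = 1` on `[-1/4, ∞)`, `φ = 0` on `(-∞, -1/2]` (Mathlib's `Real.smoothTransition`); below the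
  hyperplane the series is locally finite, hence `C^∞` (`contDiffOn_extend_of_neg`).
* *Limits of the derivatives at the hyperplane* (`tendsto_iteratedFDerivWithin_extend`): the `m`-th
  derivative of the `k`-th term is `w_k • (Dᵐ f)(A_k ·) ∘ A_k^{⊗m}` (`mainPart`, `A_k (t,x) = (-2^k t, x)`)
  plus a remainder supported in the transition zone `2^k t/δ ∈ [-1/2, -1/4]` and bounded by
  `|a_k| 2^{km} N (K_m + 1)` (Leibniz bound `norm_iteratedFDerivWithin_smul_le`, a uniform bound `N`
  for the derivatives of `f` near the compact segment `[0, δ/2] × {x₀}` by the tube lemma); by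
  Tannery's theorem the remainders tend to `0` and the main parts to `∑_k a_k (Dᵐ f)(0, x₀) ∘ A_k^{⊗m}`,
  which is `(Dᵐ f)(0, x₀)` by multilinearity and the moment identities
  (`hasSum_coeff_smul_compContinuousLinearMap_scale`).
* *Gluing the jets* (`contDiffOn_of_tendsto_iteratedFDerivWithin`): the one-sided Taylor series glue
  to a Taylor series on the open set — at hyperplane points the derivative within the closed lower
  half space exists and equals the limit from below (Mathlib's
  `hasFDerivWithinAt_closure_of_tendsto_fderiv`, the mean value inequality) and agrees with the
  derivative within the upper half space (`HasFDerivWithinAt.union`).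

## References

* R. T. Seeley, *Extension of `C^∞` functions defined in a half space*, Proc. Amer. Math. Soc. 15
  (1964), 625–626 (Theorem and Lemma, p. 625; proof of the Lemma, pp. 625–626).
* M. R. Hestenes, *Extension of the range of a differentiable function*, Duke Math. J. 8 (1941)
  (finite-order reflections, cited there).
-/

open Finset Filter Topology Polynomial
open scoped ContDiff

noncomputable section

namespace Literature.Analysis.Calculus

namespace Seeley

/-- The nodes `2^k`. [folklore] -/
def node (k : ℕ) : ℝ := 2 ^ k

/-- The nodes increase strictly. [folklore] -/
theorem node_strictMono : StrictMono node := fun a b h => pow_lt_pow_right₀ (by norm_num) h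

/-- The nodes are distinct. [folklore] -/
theorem node_injective : Function.Injective node := node_strictMono.injective

/-- The factor `(1 + 2^i) / (2^i - 2^k)` of the Lagrange coefficients at `-1`. [folklore] -/
def factor (k i : ℕ) : ℝ := (1 + 2 ^ i) / (2 ^ i - 2 ^ k)

/-- The Lagrange coefficient `ℓ_N,k(-1) = ∏_{i ≤ N, i ≠ k} (1 + 2^i) / (2^i - 2^k)`. [folklore] -/
def lag (N k : ℕ) : ℝ := ∏ i ∈ (range (N + 1)).erase k, factor k i

/-- The value at `-1` of the Lagrange basis polynomial for the nodes `2^0, …, 2^N`. [folklore] -/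
theorem eval_neg_one_basis (N k : ℕ) :
    (Lagrange.basis (range (N + 1)) node k).eval (-1) = lag N k := by
  rw [Lagrange.basis, eval_prod, lag]
  refine prod_congr rfl fun i hi => ?_
  have hik : i ≠ k := (mem_erase.1 hi).1
  have hne' : (2 : ℝ) ^ i - 2 ^ k ≠ 0 := by
    have := node_injective.ne hik; unfold node at this; exact sub_ne_zero.2 this
  have hne : (2 : ℝ) ^ k - 2 ^ i ≠ 0 := fun h => hne' (by linarith)
  rw [Lagrange.basisDivisor, eval_mul, eval_C, eval_sub, eval_X, eval_C, factor]
  unfold node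
  field_simp
  ring

/-- **Lagrange interpolation at `-1`**: `∑_{k ≤ N} ℓ_N,k(-1) (2^k)^j = (-1)^j` for `j ≤ N`. [folklore] -/
theorem sum_lag_mul_pow {N j : ℕ} (hj : j ≤ N) :
    ∑ k ∈ range (N + 1), lag N k * (2 : ℝ) ^ (k * j) = (-1) ^ j := by
  have hinj : Set.InjOn node (range (N + 1) : Finset ℕ) := node_injective.injOn
  have hdeg : ((X : ℝ[X]) ^ j).degree < #(range (N + 1)) := by
    rw [degree_X_pow, card_range]; exact_mod_cast Nat.lt_succ_of_le hj
  have h := Lagrange.eq_interpolate hinj hdeg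
  have h' := congrArg (fun p : ℝ[X] => p.eval (-1)) h
  simp only [eval_pow, eval_X, Lagrange.interpolate_apply, eval_finsetSum, eval_mul, eval_C,
    eval_neg_one_basis] at h'
  rw [h']
  refine sum_congr rfl fun k _ => ?_
  rw [node, ← pow_mul, mul_comm]

/-! ### Head and tail of the coefficients -/

/-- The head `∏_{i < k} (1 + 2^i)/(2^i - 2^k)` of the coefficient (a fixed finite product). [folklore] -/
def head (k : ℕ) : ℝ := ∏ i ∈ range k, factor k i

/-- The tail `∏_{k < i ≤ N} (1 + 2^i)/(2^i - 2^k)` of the coefficient. [folklore] -/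
def tail (k N : ℕ) : ℝ := ∏ i ∈ Ioc k N, factor k i

/-- `ℓ_N,k = A_k · B_kN`: the Lagrange coefficient splits into the fixed head (indices `< k`) and the tail (indices in `(k, N]`) — Seeley's `a_kN = A_k B_kN`. [cite: Seeley1964, Lemma] -/
theorem lag_eq_head_mul_tail {N k : ℕ} (hk : k ≤ N) : lag N k = head k * tail k N := by
  rw [lag, head, tail]
  have hdisj : Disjoint (range k) (Ioc k N) := by
    rw [disjoint_left]; intro i hi hi'
    simp only [mem_range] at hi; simp only [mem_Ioc] at hi'; omega
  have hunion : (range (N + 1)).erase k = range k ∪ Ioc k N := by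
    ext i; simp only [mem_erase, mem_range, mem_union, mem_Ioc]; omega
  rw [hunion, prod_union hdisj]

/-- The tail factors are `≥ 1`. [cite: Seeley1964, Lemma] -/
theorem one_le_factor {k i : ℕ} (h : k < i) : 1 ≤ factor k i := by
  rw [factor, le_div_iff₀ (sub_pos.2 (pow_lt_pow_right₀ (by norm_num) h))]
  have : (0 : ℝ) ≤ 2 ^ k := by positivity
  linarith

/-- The tail factors are `≤ 1 + 2 (1 + 2^k) / 2^i`. [cite: Seeley1964, Lemma] -/
theorem factor_le {k i : ℕ} (h : k < i) : factor k i ≤ 1 + 2 * (1 + 2 ^ k) / 2 ^ i := by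
  set X : ℝ := 2 ^ i with hX
  set Y : ℝ := 2 ^ k with hY
  have h2i : 0 < X := by positivity
  have hki : Y * 2 ≤ X := by
    rw [hX, hY, ← pow_succ]; exact pow_le_pow_right₀ (by norm_num) h
  have hY0 : 0 ≤ Y := by positivity
  have hden' : 0 < X - Y := by linarith
  rw [factor, div_le_iff₀ hden']
  have heq : (1 + 2 * (1 + Y) / X) * (X - Y) = ((X + 2 * (1 + Y)) * (X - Y)) / X := by
    field_simp
  rw [heq, le_div_iff₀ h2i]
  nlinarith [mul_nonneg (by linarith : (0 : ℝ) ≤ 1 + Y) (by linarith : (0 : ℝ) ≤ X - 2 * Y)]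

/-- The tails are `≥ 1`. [cite: Seeley1964, Lemma] -/
theorem one_le_tail (k N : ℕ) : 1 ≤ tail k N :=
  one_le_prod fun _ hi => one_le_factor (mem_Ioc.1 hi).1

/-- The tails `B_kN` increase with `N` ("`B_kN` is monotone increasing with `N`"). [cite: Seeley1964, Lemma] -/
theorem tail_mono (k : ℕ) : Monotone (tail k) := by
  refine monotone_nat_of_le_succ fun N => ?_
  by_cases h : k ≤ N
  · rw [tail, tail, prod_Ioc_succ_top h]
    exact le_mul_of_one_le_right (zero_le_one.trans (one_le_tail k N)) (one_le_factor (by omega))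
  · have h1 : Ioc k N = ∅ := Finset.Ioc_eq_empty (by omega)
    have h2 : Ioc k (N + 1) = ∅ := Finset.Ioc_eq_empty (by omega)
    rw [tail, tail, h1, h2]

/-- The geometric tail bound `∑_{k < i ≤ N} (1/2)^i ≤ (1/2)^k`. [folklore] -/
theorem sum_Ioc_half_pow_le (k N : ℕ) : ∑ i ∈ Ioc k N, (1 / 2 : ℝ) ^ i ≤ (1 / 2) ^ k := by
  rw [← Finset.Ico_add_one_add_one_eq_Ioc, sum_Ico_eq_sum_range]
  calc ∑ m ∈ range (N + 1 - (k + 1)), (1 / 2 : ℝ) ^ (k + 1 + m)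
      = (1 / 2) ^ (k + 1) * ∑ m ∈ range (N + 1 - (k + 1)), (1 / 2 : ℝ) ^ m := by
        rw [mul_sum]; refine sum_congr rfl fun m _ => ?_; rw [pow_add]
    _ ≤ (1 / 2) ^ (k + 1) * 2 :=
        mul_le_mul_of_nonneg_left (sum_geometric_two_le _) (by positivity)
    _ = (1 / 2) ^ k := by rw [pow_succ]; ring

/-- The tails are bounded by `e⁴` ("`log B_kN < 4`"). [cite: Seeley1964, Lemma] -/
theorem tail_le (k N : ℕ) : tail k N ≤ Real.exp 4 := by
  have hle : tail k N ≤ ∏ i ∈ Ioc k N, Real.exp (2 * (1 + 2 ^ k) / 2 ^ i) := by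
    refine prod_le_prod (fun i hi => (zero_le_one.trans (one_le_factor (mem_Ioc.1 hi).1)))
      fun i hi => ?_
    have := factor_le (mem_Ioc.1 hi).1
    have h' := Real.add_one_le_exp (2 * (1 + 2 ^ k) / 2 ^ i)
    linarith
  refine hle.trans ?_
  rw [← Real.exp_sum, Real.exp_le_exp]
  have hsum : ∑ i ∈ Ioc k N, 2 * (1 + (2 : ℝ) ^ k) / 2 ^ i =
      2 * (1 + 2 ^ k) * ∑ i ∈ Ioc k N, (1 / 2 : ℝ) ^ i := by
    rw [mul_sum]; refine sum_congr rfl fun i _ => ?_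
    rw [one_div_pow, div_eq_mul_one_div]
  rw [hsum]
  have hk : (1 + (2 : ℝ) ^ k) * (1 / 2) ^ k = (1 / 2) ^ k + 1 := by
    rw [add_mul, one_mul, one_div_pow, mul_one_div, div_self (by positivity)]
  have h0 : (0 : ℝ) ≤ 1 + 2 ^ k := by positivity
  calc 2 * (1 + (2 : ℝ) ^ k) * ∑ i ∈ Ioc k N, (1 / 2 : ℝ) ^ i
      ≤ 2 * (1 + 2 ^ k) * (1 / 2) ^ k :=
        mul_le_mul_of_nonneg_left (sum_Ioc_half_pow_le k N) (by positivity)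
    _ = 2 * ((1 / 2) ^ k + 1) := by rw [mul_assoc, hk]
    _ ≤ 4 := by
        have : (1 / 2 : ℝ) ^ k ≤ 1 := pow_le_one₀ (by norm_num) (by norm_num)
        linarith

/-- The limit of the tails. [folklore] -/
def tailLim (k : ℕ) : ℝ := ⨆ N, tail k N

/-- The tails converge ("and converges to `B_k ≤ e⁴`"). [cite: Seeley1964, Lemma] -/
theorem tendsto_tail (k : ℕ) : Tendsto (tail k) atTop (𝓝 (tailLim k)) :=
  tendsto_atTop_ciSup (tail_mono k) ⟨Real.exp 4, by rintro _ ⟨N, rfl⟩; exact tail_le k N⟩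

/-- `1 ≤ B_k`. [cite: Seeley1964, Lemma] -/
theorem one_le_tailLim (k : ℕ) : 1 ≤ tailLim k :=
  le_ciSup_of_le ⟨Real.exp 4, by rintro _ ⟨N, rfl⟩; exact tail_le k N⟩ 0 (one_le_tail k 0)

/-- `B_k ≤ e⁴`. [cite: Seeley1964, Lemma] -/
theorem tailLim_le (k : ℕ) : tailLim k ≤ Real.exp 4 := ciSup_le fun N => tail_le k N

/-- **Seeley's coefficients** `a_k = lim_N ℓ_N,k(-1)`. [folklore] -/
def coeff (k : ℕ) : ℝ := head k * tailLim k

/-- The Lagrange coefficients `a_kN = A_k B_kN` converge to `a_k = A_k B_k`. [cite: Seeley1964, Lemma] -/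
theorem tendsto_lag (k : ℕ) : Tendsto (fun N => lag N k) atTop (𝓝 (coeff k)) := by
  have h : (fun N => lag N k) =ᶠ[atTop] fun N => head k * tail k N := by
    filter_upwards [eventually_ge_atTop k] with N hN
    exact lag_eq_head_mul_tail hN
  rw [tendsto_congr' h]
  exact (tendsto_tail k).const_mul _

/-! ### Bounds -/

/-- The bound `B_k = ∏_{i<k} 4·2^i/2^k` for `|head k|`. [folklore] -/
def headBound (k : ℕ) : ℝ := ∏ i ∈ range k, (4 * 2 ^ i / 2 ^ k : ℝ)

/-- The head bound is positive. [folklore] -/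
theorem headBound_pos (k : ℕ) : 0 < headBound k := prod_pos fun i _ => by positivity

/-- The head factors are bounded by `4 · 2^i / 2^k` in absolute value. [cite: Seeley1964, Lemma] -/
theorem abs_factor_le {k i : ℕ} (h : i < k) : |factor k i| ≤ 4 * 2 ^ i / 2 ^ k := by
  have h2k : (0 : ℝ) < 2 ^ k := by positivity
  have hik : (2 : ℝ) ^ i * 2 ≤ 2 ^ k := by
    rw [← pow_succ]; exact pow_le_pow_right₀ (by norm_num) h
  have hneg : (2 : ℝ) ^ i - 2 ^ k < 0 := by linarith [pow_pos (two_pos : (0:ℝ) < 2) i]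
  rw [factor, abs_div, abs_of_pos (by positivity : (0 : ℝ) < 1 + 2 ^ i), abs_of_neg hneg,
    div_le_div_iff₀ (by linarith) h2k]
  have h1 : (1 : ℝ) ≤ 2 ^ i := one_le_pow₀ (by norm_num)
  nlinarith

/-- `|A_k| ≤ B_k` (Seeley: `|A_k| ≤ ∏_{j<k} 2^{j+2-k} = 2^{(3k-k²)/2}`). [cite: Seeley1964, Lemma] -/
theorem abs_head_le (k : ℕ) : |head k| ≤ headBound k := by
  rw [head, abs_prod, headBound]
  exact prod_le_prod (fun i _ => abs_nonneg _) fun i hi => abs_factor_le (mem_range.1 hi)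

/-- Closed form of the head bound. [folklore] -/
theorem headBound_eq (k : ℕ) :
    headBound k = 4 ^ k * (∏ i ∈ range k, (2 : ℝ) ^ i) / (2 ^ k) ^ k := by
  simp only [headBound, prod_div_distrib, prod_mul_distrib, prod_const, card_range]

/-- The head bounds decay super-geometrically: `B_{k+1} = 2 · 2^{-k} B_k`. [folklore] -/
theorem headBound_succ (k : ℕ) : headBound (k + 1) = 2 * (1 / 2) ^ k * headBound k := by
  rw [headBound_eq, headBound_eq, prod_range_succ, one_div_pow]
  have h2 : (2 : ℝ) ^ k ≠ 0 := by positivity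
  field_simp
  ring

/-- The dominating sequence `c_k = e⁴ B_k 2^{kj}` for `|ℓ_N,k| 2^{kj}` and `|a_k| 2^{kj}`. [folklore] -/
def bound (j k : ℕ) : ℝ := Real.exp 4 * headBound k * 2 ^ (k * j)

/-- The dominating sequence is positive. [folklore] -/
theorem bound_pos (j k : ℕ) : 0 < bound j k := by
  unfold bound; exact mul_pos (mul_pos (Real.exp_pos _) (headBound_pos k)) (by positivity)

/-- Ratio of consecutive terms of the dominating sequence. [folklore] -/
theorem bound_succ_div (j k : ℕ) : bound j (k + 1) / bound j k = 2 ^ (j + 1) * (1 / 2) ^ k := by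
  rw [bound, bound, headBound_succ, one_div_pow]
  have h1 : Real.exp 4 ≠ 0 := (Real.exp_pos _).ne'
  have h2 : headBound k ≠ 0 := (headBound_pos k).ne'
  have h3 : (2 : ℝ) ^ (k * j) ≠ 0 := by positivity
  field_simp
  ring

/-- The dominating sequence is summable (ratio test). [folklore] -/
theorem summable_bound (j : ℕ) : Summable (bound j) := by
  refine summable_of_ratio_test_tendsto_lt_one zero_lt_one
    (Eventually.of_forall fun k => (bound_pos j k).ne') ?_
  have h : (fun k => ‖bound j (k + 1)‖ / ‖bound j k‖) = fun k => 2 ^ (j + 1) * (1 / 2 : ℝ) ^ k := by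
    funext k
    rw [Real.norm_of_nonneg (bound_pos j _).le, Real.norm_of_nonneg (bound_pos j _).le,
      bound_succ_div]
  rw [h]
  have := (tendsto_pow_atTop_nhds_zero_of_lt_one (by norm_num : (0 : ℝ) ≤ 1 / 2)
    (by norm_num : (1 / 2 : ℝ) < 1)).const_mul ((2 : ℝ) ^ (j + 1))
  simpa using this

/-- Domination of the truncated moments `|a_kN (2^k)^j| ≤ c_k`. [cite: Seeley1964, Lemma] -/
theorem abs_lag_mul_pow_le {N k : ℕ} (hk : k ≤ N) (j : ℕ) :
    |lag N k * (2 : ℝ) ^ (k * j)| ≤ bound j k := by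
  rw [lag_eq_head_mul_tail hk, abs_mul, abs_mul, abs_of_pos (lt_of_lt_of_le one_pos (one_le_tail k N)),
    abs_of_pos (by positivity : (0 : ℝ) < 2 ^ (k * j)), bound]
  have h1 := abs_head_le k
  have h2 := tail_le k N
  have h3 : (0 : ℝ) ≤ tail k N := zero_le_one.trans (one_le_tail k N)
  have h4 : (0 : ℝ) ≤ 2 ^ (k * j) := by positivity
  have h5 := (headBound_pos k).le
  calc |head k| * tail k N * 2 ^ (k * j) ≤ headBound k * Real.exp 4 * 2 ^ (k * j) := by gcongr
    _ = Real.exp 4 * headBound k * 2 ^ (k * j) := by ring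

/-- Domination `|a_k (2^k)^j| ≤ c_k`. [cite: Seeley1964, Lemma] -/
theorem abs_coeff_mul_pow_le (k j : ℕ) : |coeff k * (2 : ℝ) ^ (k * j)| ≤ bound j k := by
  rw [coeff, abs_mul, abs_mul, abs_of_pos (lt_of_lt_of_le one_pos (one_le_tailLim k)),
    abs_of_pos (by positivity : (0 : ℝ) < 2 ^ (k * j)), bound]
  have h1 := abs_head_le k
  have h2 := tailLim_le k
  have h3 : (0 : ℝ) ≤ tailLim k := zero_le_one.trans (one_le_tailLim k)
  have h4 : (0 : ℝ) ≤ 2 ^ (k * j) := by positivity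
  have h5 := (headBound_pos k).le
  calc |head k| * tailLim k * 2 ^ (k * j) ≤ headBound k * Real.exp 4 * 2 ^ (k * j) := by gcongr
    _ = Real.exp 4 * headBound k * 2 ^ (k * j) := by ring

/-- **Summability**: `∑_k |a_k| (2^k)^j < ∞` for every `j`. [folklore] -/
theorem summable_abs_coeff_mul_pow (j : ℕ) : Summable fun k => |coeff k| * (2 : ℝ) ^ (k * j) := by
  refine (summable_bound j).of_nonneg_of_le (fun k => by positivity) fun k => ?_
  have := abs_coeff_mul_pow_le k j
  rwa [abs_mul, abs_of_pos (by positivity : (0 : ℝ) < 2 ^ (k * j))] at this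

/-- `∑_k a_k (2^k)^j` converges absolutely (Seeley's (ii): `∑ |a_k| |b_k|ⁿ < ∞`). [cite: Seeley1964, Lemma (ii)] -/
theorem summable_coeff_mul_pow (j : ℕ) : Summable fun k => coeff k * (2 : ℝ) ^ (k * j) :=
  (summable_bound j).of_norm_bounded fun k => (Real.norm_eq_abs _).le.trans (abs_coeff_mul_pow_le k j)

/-- **The moment identities**: `∑_k a_k (2^k)^j = (-1)^j` for every `j` (Lagrange interpolation
in the limit `N → ∞`, by Tannery's theorem). [folklore] -/
theorem tsum_coeff_mul_pow (j : ℕ) : ∑' k, coeff k * (2 : ℝ) ^ (k * j) = (-1) ^ j := by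
  -- truncated sequences
  set f : ℕ → ℕ → ℝ := fun N k => if k ≤ N then lag N k * 2 ^ (k * j) else 0 with hf
  have hlim : Tendsto (fun N => ∑' k, f N k) atTop (𝓝 (∑' k, coeff k * (2 : ℝ) ^ (k * j))) := by
    refine tendsto_tsum_of_dominated_convergence (summable_bound j) (fun k => ?_) ?_
    · have h : (fun N => f N k) =ᶠ[atTop] fun N => lag N k * 2 ^ (k * j) := by
        filter_upwards [eventually_ge_atTop k] with N hN
        simp [hf, hN]
      rw [tendsto_congr' h]
      exact (tendsto_lag k).mul_const _
    · refine Eventually.of_forall fun N k => ?_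
      by_cases hk : k ≤ N
      · simp only [hf, hk, ↓reduceIte, Real.norm_eq_abs]
        exact abs_lag_mul_pow_le hk j
      · simp only [hf, hk, ↓reduceIte, norm_zero]
        exact (bound_pos j k).le
  have hconst : (fun N => ∑' k, f N k) =ᶠ[atTop] fun _ => (-1 : ℝ) ^ j := by
    filter_upwards [eventually_ge_atTop j] with N hN
    have hsupp : ∀ k ∉ range (N + 1), f N k = 0 := by
      intro k hk; simp only [mem_range, not_lt] at hk
      simp [hf, show ¬ k ≤ N by omega]
    rw [tsum_eq_sum hsupp, ← sum_lag_mul_pow hN]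
    refine sum_congr rfl fun k hk => ?_
    simp [hf, Nat.lt_succ_iff.1 (mem_range.1 hk)]
  rw [tendsto_congr' hconst] at hlim
  exact (tendsto_nhds_unique tendsto_const_nhds hlim).symm

/-- The moment identities in Seeley's form: `∑_k a_k (-2^k)^j = 1`. [folklore] -/
theorem tsum_coeff_mul_neg_pow (j : ℕ) : ∑' k, coeff k * (-(2 : ℝ) ^ k) ^ j = 1 := by
  have h : (fun k => coeff k * (-(2 : ℝ) ^ k) ^ j) = fun k => (-1) ^ j * (coeff k * 2 ^ (k * j)) := by
    funext k; rw [neg_pow, pow_mul]; ring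
  rw [h, tsum_mul_left, tsum_coeff_mul_pow, ← pow_add, ← two_mul, pow_mul]
  norm_num

/-! ### The cutoff, the scalings and the extension operator -/

/-- The cutoff `φ`: smooth, `φ = 1` on `[-1/4, ∞)`, `φ = 0` on `(-∞, -1/2]`. [folklore] -/
def cutoff (s : ℝ) : ℝ := Real.smoothTransition (4 * s + 2)

/-- The cutoff vanishes on `(-∞, -1/2]`. [folklore] -/
theorem cutoff_of_le {s : ℝ} (hs : s ≤ -1 / 2) : cutoff s = 0 :=
  Real.smoothTransition.zero_of_nonpos (by linarith)

/-- The cutoff is `1` on `[-1/4, ∞)`. [folklore] -/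
theorem cutoff_of_ge {s : ℝ} (hs : -1 / 4 ≤ s) : cutoff s = 1 :=
  Real.smoothTransition.one_of_one_le (by linarith)

/-- The cutoff is smooth. [folklore] -/
theorem contDiff_cutoff {n : ℕ∞} : ContDiff ℝ n cutoff :=
  Real.smoothTransition.contDiff.comp ((contDiff_const.mul contDiff_id).add contDiff_const)

/-- The cutoff is nonnegative. [folklore] -/
theorem cutoff_nonneg (s : ℝ) : 0 ≤ cutoff s := Real.smoothTransition.nonneg _

/-- The cutoff is at most `1`. [folklore] -/
theorem cutoff_le_one (s : ℝ) : cutoff s ≤ 1 := Real.smoothTransition.le_one _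

section Operator

variable {E' F : Type*} [NormedAddCommGroup E'] [NormedSpace ℝ E'] [NormedAddCommGroup F]
  [NormedSpace ℝ F]

/-- The scalings `A_k (t, x) = (-2^k t, x)` (reflection across the hyperplane composed with a
dilation normal to it). [folklore] -/
def scale (k : ℕ) : ℝ × E' →L[ℝ] ℝ × E' :=
  ((-(2 : ℝ) ^ k) • ContinuousLinearMap.fst ℝ ℝ E').prod (ContinuousLinearMap.snd ℝ ℝ E')

/-- `A_k (t, x) = (-2^k t, x)`. [cite: Seeley1964, Theorem] -/
@[simp] theorem scale_apply (k : ℕ) (p : ℝ × E') : scale k p = (-(2 : ℝ) ^ k * p.1, p.2) := by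
  simp [scale]

end Operator

/-- The `k`-th cutoff factor `a_k φ(2^k t / δ)` (a function of the height `t`). [folklore] -/
def weight (δ : ℝ) (k : ℕ) (t : ℝ) : ℝ := coeff k * cutoff (2 ^ k * t / δ)

/-- The weights are smooth. [folklore] -/
theorem contDiff_weight (δ : ℝ) (k : ℕ) {n : ℕ∞} : ContDiff ℝ n (weight δ k) := by
  unfold weight
  exact contDiff_const.mul (contDiff_cutoff.comp ((contDiff_const.mul contDiff_id).div_const _))

/-- The weight vanishes where `2^k t / δ ≤ -1/2`. [folklore] -/
theorem weight_eq_zero {δ : ℝ} {k : ℕ} {t : ℝ} (ht : 2 ^ k * t / δ ≤ -1 / 2) : weight δ k t = 0 := by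
  rw [weight, cutoff_of_le ht, mul_zero]

/-- The weight is `a_k` where `2^k t / δ ≥ -1/4` (in particular near the hyperplane). [folklore] -/
theorem weight_eq_coeff {δ : ℝ} {k : ℕ} {t : ℝ} (ht : -1 / 4 ≤ 2 ^ k * t / δ) :
    weight δ k t = coeff k := by
  rw [weight, cutoff_of_ge ht, mul_one]

/-- `|w_k| ≤ |a_k|`. [folklore] -/
theorem abs_weight_le (δ : ℝ) (k : ℕ) (t : ℝ) : |weight δ k t| ≤ |coeff k| := by
  rw [weight, abs_mul]
  exact mul_le_of_le_one_right (abs_nonneg _)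
    (by rw [abs_of_nonneg (cutoff_nonneg _)]; exact cutoff_le_one _)

section Operator

variable {E' F : Type*} [NormedAddCommGroup E'] [NormedSpace ℝ E'] [NormedAddCommGroup F]
  [NormedSpace ℝ F]

/-- The `k`-th term `a_k φ(2^k t / δ) f(-2^k t, x)` of Seeley's series. [folklore] -/
def term (δ : ℝ) (f : ℝ × E' → F) (k : ℕ) (p : ℝ × E') : F := weight δ k p.1 • f (scale k p)

/-- **Seeley's extension operator**: `E f = f` on `{t ≥ 0}` and
`E f (t, x) = ∑_k a_k φ(2^k t / δ) f(-2^k t, x)` for `t < 0`. [folklore] -/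
def extend (δ : ℝ) (f : ℝ × E' → F) (p : ℝ × E') : F :=
  if 0 ≤ p.1 then f p else ∑' k, term δ f k p

variable {δ : ℝ} {f : ℝ × E' → F} {B : Set E'}

/-- `E f = f` on the closed upper half space. [cite: Seeley1964, Theorem] -/
theorem extend_of_nonneg {p : ℝ × E'} (hp : 0 ≤ p.1) : extend δ f p = f p := if_pos hp

/-- `E f` is Seeley's series below the hyperplane. [cite: Seeley1964, Theorem] -/
theorem extend_of_neg {p : ℝ × E'} (hp : p.1 < 0) : extend δ f p = ∑' k, term δ f k p :=
  if_neg (not_le.2 hp)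

/-! ### Smoothness below the hyperplane: the series is locally finite -/

variable (hδ : 0 < δ)
include hδ

/-- For `t < t₀ / 2 < 0` and `2^k ≥ δ / |t₀|` the `k`-th weight vanishes. [folklore] -/
theorem weight_eq_zero_of_lt {t₀ : ℝ} (ht₀ : t₀ < 0) {k : ℕ} (hk : δ / (-t₀) ≤ 2 ^ k)
    {t : ℝ} (hp : t < t₀ / 2) : weight δ k t = 0 := by
  apply weight_eq_zero
  rw [div_le_iff₀ hδ]
  have h1 : δ ≤ 2 ^ k * (-t₀) := by rwa [div_le_iff₀ (by linarith)] at hk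
  have h2 : (0 : ℝ) < 2 ^ k := by positivity
  nlinarith

/-- Near a point below the hyperplane, Seeley's series is a finite sum. [folklore] -/
theorem extend_eq_sum_of_lt {t₀ : ℝ} (ht₀ : t₀ < 0) {K : ℕ} (hK : δ / (-t₀) ≤ 2 ^ K)
    {p : ℝ × E'} (hp : p.1 < t₀ / 2) :
    extend δ f p = ∑ k ∈ range K, term δ f k p := by
  rw [extend_of_neg (by linarith)]
  refine tsum_eq_sum fun k hk => ?_
  simp only [mem_range, not_lt] at hk
  rw [term, weight_eq_zero_of_lt hδ ht₀ (hK.trans (pow_le_pow_right₀ (by norm_num) hk)) hp,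
    zero_smul]

/-- Each term is smooth at every point `(t, x)`, `t < 0`, `x ∈ B`, if `f` is smooth on the open
slab `(0, δ) × B`. [folklore] -/
theorem contDiffAt_term (hB : IsOpen B) (hf : ContDiffOn ℝ ∞ f (Set.Ioo 0 δ ×ˢ B)) (k : ℕ)
    {p : ℝ × E'} (hp1 : p.1 < 0) (hp2 : p.2 ∈ B) : ContDiffAt ℝ ∞ (term δ f k) p := by
  by_cases h : -1 < 2 ^ k * p.1 / δ
  · -- the argument of `f` lies in the open slab
    have h2k : (0 : ℝ) < 2 ^ k := by positivity
    have hmem : scale k p ∈ Set.Ioo 0 δ ×ˢ B := by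
      refine ⟨⟨?_, ?_⟩, by simpa using hp2⟩
      · simp only [scale_apply]; nlinarith
      · simp only [scale_apply]
        rw [lt_div_iff₀ hδ] at h; nlinarith
    have hfa : ContDiffAt ℝ ∞ f (scale k p) :=
      hf.contDiffAt ((isOpen_Ioo.prod hB).mem_nhds hmem)
    exact ((contDiff_weight δ k).comp contDiff_fst).contDiffAt.smul
      (hfa.comp p ((scale k : ℝ × E' →L[ℝ] ℝ × E').contDiff (n := ∞)).contDiffAt)
  · have h : 2 ^ k * p.1 / δ ≤ -1 := not_lt.1 h
    -- the weight vanishes identically near `p`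
    have hev : term δ f k =ᶠ[𝓝 p] fun _ => 0 := by
      have ho : IsOpen {q : ℝ × E' | 2 ^ k * q.1 / δ < -1 / 2} :=
        isOpen_lt ((continuous_const.mul continuous_fst).div_const _) continuous_const
      filter_upwards [ho.mem_nhds (show 2 ^ k * p.1 / δ < -1 / 2 by linarith)] with q hq
      rw [term, weight_eq_zero hq.le, zero_smul]
    exact contDiffAt_const.congr_of_eventuallyEq hev

/-- **Seeley's extension is smooth below the hyperplane.** [folklore] -/
theorem contDiffOn_extend_of_neg (hB : IsOpen B) (hf : ContDiffOn ℝ ∞ f (Set.Ioo 0 δ ×ˢ B)) :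
    ContDiffOn ℝ ∞ (extend δ f) (Set.Iio 0 ×ˢ B) := by
  rintro ⟨t₀, x₀⟩ ⟨ht₀, hx₀⟩
  simp only [Set.mem_Iio] at ht₀
  obtain ⟨K, hK⟩ : ∃ K : ℕ, δ / (-t₀) ≤ 2 ^ K :=
    (pow_unbounded_of_one_lt (δ / (-t₀)) (by norm_num : (1 : ℝ) < 2)).imp fun _ h => h.le
  -- on the neighbourhood `{t < t₀ / 2} × B` the series is a finite sum of smooth terms
  have hV : Set.Iio (t₀ / 2) ×ˢ B ∈ 𝓝 (t₀, x₀) :=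
    (isOpen_Iio.prod hB).mem_nhds ⟨by simp only [Set.mem_Iio]; linarith, hx₀⟩
  have heq : extend δ f =ᶠ[𝓝 (t₀, x₀)] fun p => ∑ k ∈ range K, term δ f k p := by
    filter_upwards [hV] with p hp
    exact extend_eq_sum_of_lt hδ ht₀ hK hp.1
  have hsum : ContDiffAt ℝ ∞ (fun p => ∑ k ∈ range K, term δ f k p) (t₀, x₀) :=
    ContDiffAt.sum fun k _ => contDiffAt_term hδ hB hf k ht₀ hx₀
  exact (hsum.congr_of_eventuallyEq heq).contDiffWithinAt

end Operator

/-! ### The moment identities for multilinear maps -/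

section Multilinear

variable {E' F : Type*} [NormedAddCommGroup E'] [NormedSpace ℝ E'] [NormedAddCommGroup F]
  [NormedSpace ℝ F]

/-- The projection `(t, x) ↦ (0, x)` onto the hyperplane. [folklore] -/
def projH : ℝ × E' →L[ℝ] ℝ × E' := (ContinuousLinearMap.inr ℝ ℝ E').comp (ContinuousLinearMap.snd ℝ ℝ E')

/-- The projection `(t, x) ↦ (t, 0)` onto the normal line. [folklore] -/
def projN : ℝ × E' →L[ℝ] ℝ × E' := (ContinuousLinearMap.inl ℝ ℝ E').comp (ContinuousLinearMap.fst ℝ ℝ E')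

/-- `P (t, x) = (0, x)`. [folklore] -/
@[simp] theorem projH_apply (p : ℝ × E') : projH p = (0, p.2) := rfl

/-- `Q (t, x) = (t, 0)`. [folklore] -/
@[simp] theorem projN_apply (p : ℝ × E') : projN p = (p.1, 0) := rfl

/-- `A_k = P - 2^k Q`. [folklore] -/
theorem scale_eq (k : ℕ) : (scale k : ℝ × E' →L[ℝ] ℝ × E') = projH + (-(2 : ℝ) ^ k) • projN := by
  ext p <;> simp

/-- `Q + P = id`. [folklore] -/
theorem projN_add_projH_apply (p : ℝ × E') : projN p + projH p = p := by
  ext <;> simp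

variable {m : ℕ} (M : ContinuousMultilinearMap ℝ (fun _ : Fin m => ℝ × E') F)

/-- The mixed restrictions of `M`: normal component in the slots of `s`, tangential elsewhere. [folklore] -/
def mixed (s : Finset (Fin m)) : ContinuousMultilinearMap ℝ (fun _ : Fin m => ℝ × E') F :=
  M.compContinuousLinearMap fun i => if i ∈ s then projN else projH

/-- Evaluation of the mixed restrictions. [folklore] -/
theorem mixed_apply (s : Finset (Fin m)) (v : Fin m → ℝ × E') :
    mixed M s v = M (s.piecewise (fun i => projN (v i)) fun i => projH (v i)) := by
  rw [mixed, ContinuousMultilinearMap.compContinuousLinearMap_apply]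
  congr 1
  funext i
  by_cases hi : i ∈ s <;> simp [hi, Finset.piecewise]

/-- Expansion of `M ∘ (P + c Q)^{⊗m}` by multilinearity. [folklore] -/
theorem compContinuousLinearMap_projH_add_smul_projN (c : ℝ) :
    M.compContinuousLinearMap (fun _ => projH + c • projN) = ∑ s, c ^ s.card • mixed M s := by
  ext v
  rw [ContinuousMultilinearMap.compContinuousLinearMap_apply, _root_.sum_apply]
  have h : (fun i => (projH + c • projN : ℝ × E' →L[ℝ] ℝ × E') (v i)) =
      (fun i => c • projN (v i)) + fun i => projH (v i) := by
    funext i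
    simp only [Pi.add_apply, _root_.add_apply, _root_.smul_apply]
    rw [add_comm]
  rw [h, ContinuousMultilinearMap.map_add_univ]
  refine Finset.sum_congr rfl fun s _ => ?_
  rw [_root_.smul_apply, mixed_apply]
  set w : Fin m → ℝ × E' := s.piecewise (fun i => projN (v i)) fun i => projH (v i) with hw
  have hpw : s.piecewise (fun i => c • projN (v i)) (fun i => projH (v i)) =
      s.piecewise (fun i => c • w i) w := by
    funext i
    by_cases hi : i ∈ s <;> simp [Finset.piecewise, hi, hw]
  have := M.map_piecewise_smul (fun _ => c) w s
  rw [Finset.prod_const] at this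
  rw [hpw, this]

/-- Re-collapsing the expansion: `∑_s M_s = M`. [folklore] -/
theorem sum_mixed : ∑ s, mixed M s = M := by
  ext v
  rw [_root_.sum_apply]
  have h := (ContinuousMultilinearMap.map_add_univ M (fun i => projN (v i)) fun i => projH (v i)).symm
  simp only [mixed_apply]
  rw [h]
  congr 1
  funext i
  exact projN_add_projH_apply (v i)

/-- **The moment identities for multilinear maps**: `∑_k a_k M ∘ A_k^{⊗m} = M` for every
continuous multilinear `M`, where `A_k (t, x) = (-2^k t, x)` (expand by multilinearity and use
`∑_k a_k (-2^k)^j = 1` for every `j`). [folklore] -/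
theorem hasSum_coeff_smul_compContinuousLinearMap_scale :
    HasSum (fun k => coeff k • M.compContinuousLinearMap fun _ => scale k) M := by
  have h : (fun k => coeff k • M.compContinuousLinearMap fun _ => scale k) =
      fun k => ∑ s : Finset (Fin m), (coeff k * (-(2 : ℝ) ^ k) ^ s.card) • mixed M s := by
    funext k
    rw [scale_eq, compContinuousLinearMap_projH_add_smul_projN, Finset.smul_sum]
    refine Finset.sum_congr rfl fun s _ => ?_
    rw [smul_smul]
  rw [h]
  suffices key : HasSum (fun k => ∑ s : Finset (Fin m), (coeff k * (-(2 : ℝ) ^ k) ^ s.card) • mixed M s)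
      (∑ s : Finset (Fin m), (1 : ℝ) • mixed M s) by
    simpa only [one_smul, sum_mixed] using key
  refine hasSum_sum fun s _ => ?_
  have hsum : Summable fun k => coeff k * (-(2 : ℝ) ^ k) ^ s.card := by
    have h1 := summable_coeff_mul_pow s.card
    have h2 : (fun k => coeff k * (-(2 : ℝ) ^ k) ^ s.card) =
        fun k => (-1) ^ s.card * (coeff k * 2 ^ (k * s.card)) := by
      funext k; rw [neg_pow, pow_mul]; ring
    rw [h2]
    exact h1.mul_left _
  have hs : HasSum (fun k => coeff k * (-(2 : ℝ) ^ k) ^ s.card) 1 := by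
    rw [← tsum_coeff_mul_neg_pow s.card]
    exact hsum.hasSum
  exact hs.smul_const (mixed M s)

end Multilinear

/-! ### Bounds for the derivatives of the terms -/

/-- The derivatives of the cutoff are bounded. [folklore] -/
theorem exists_bound_iteratedFDeriv_cutoff (i : ℕ) : ∃ C : ℝ, 0 ≤ C ∧ ∀ s, ‖iteratedFDeriv ℝ i cutoff s‖ ≤ C := by
  -- bounded on the compact `[-1, 0]` by continuity, locally constant outside `(-3/4, -1/8)`
  have hcd : ContDiff ℝ ∞ cutoff := contDiff_cutoff
  have hc : Continuous fun s => ‖iteratedFDeriv ℝ i cutoff s‖ :=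
    (hcd.continuous_iteratedFDeriv (by exact_mod_cast le_top)).norm
  obtain ⟨C, hC⟩ := (isCompact_Icc (a := (-1 : ℝ)) (b := 0)).exists_bound_of_continuousOn hc.continuousOn
  refine ⟨max C 1, le_max_of_le_right zero_le_one, fun s => ?_⟩
  by_cases hs : s ∈ Set.Icc (-1 : ℝ) 0
  · have h1 := hC s hs
    rw [Real.norm_of_nonneg (norm_nonneg _)] at h1
    exact h1.trans (le_max_left _ _)
  · -- near `s` the cutoff is constant
    have hconst : ∃ c : ℝ, cutoff =ᶠ[𝓝 s] fun _ => c := by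
      rcases not_and_or.1 hs with h | h
      · refine ⟨0, ?_⟩
        have h' : s < -1 := lt_of_not_ge h
        filter_upwards [Iio_mem_nhds (show s < -3 / 4 by linarith)] with y hy
        exact cutoff_of_le (by simp only [Set.mem_Iio] at hy; linarith)
      · refine ⟨1, ?_⟩
        have h' : 0 < s := lt_of_not_ge h
        filter_upwards [Ioi_mem_nhds (show -1 / 8 < s by linarith)] with y hy
        exact cutoff_of_ge (by simp only [Set.mem_Ioi] at hy; linarith)
    obtain ⟨c, hc'⟩ := hconst
    have h1 : iteratedFDeriv ℝ i cutoff s = iteratedFDeriv ℝ i (fun _ : ℝ => c) s :=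
      (hc'.iteratedFDeriv ℝ i).eq_of_nhds
    rw [h1]
    rcases i with _ | i
    · rw [norm_iteratedFDeriv_zero]
      -- `c` is a value of the cutoff, so `|c| ≤ 1`
      have : c = cutoff s := (hc'.eq_of_nhds).symm
      rw [this, Real.norm_eq_abs, abs_of_nonneg (cutoff_nonneg _)]
      exact (cutoff_le_one _).trans (le_max_right _ _)
    · rw [iteratedFDeriv_const_of_ne (by omega), Pi.zero_apply, norm_zero]
      exact le_trans zero_le_one (le_max_right _ _)

/-- A fixed bound `C_i` for the `i`-th derivative of the cutoff. [folklore] -/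
def cutoffBound (i : ℕ) : ℝ := Classical.choose (exists_bound_iteratedFDeriv_cutoff i)

/-- The cutoff bounds are nonnegative. [folklore] -/
theorem cutoffBound_nonneg (i : ℕ) : 0 ≤ cutoffBound i :=
  (Classical.choose_spec (exists_bound_iteratedFDeriv_cutoff i)).1

/-- `‖Dⁱ φ‖ ≤ Cᵢ`. [folklore] -/
theorem norm_iteratedFDeriv_cutoff_le (i : ℕ) (s : ℝ) : ‖iteratedFDeriv ℝ i cutoff s‖ ≤ cutoffBound i :=
  (Classical.choose_spec (exists_bound_iteratedFDeriv_cutoff i)).2 s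

section TermBounds

variable {E' F : Type*} [NormedAddCommGroup E'] [NormedSpace ℝ E'] [NormedAddCommGroup F]
  [NormedSpace ℝ F]

/-- `‖A_k‖ ≤ 2^k`. [folklore] -/
theorem norm_scale_le (k : ℕ) : ‖(scale k : ℝ × E' →L[ℝ] ℝ × E')‖ ≤ 2 ^ k := by
  refine ContinuousLinearMap.opNorm_le_bound _ (by positivity) fun p => ?_
  rw [scale_apply, Prod.norm_def, Prod.norm_def]
  have h1 : (1 : ℝ) ≤ 2 ^ k := one_le_pow₀ (by norm_num)
  refine max_le ?_ ?_
  · rw [norm_mul, norm_neg, norm_pow, Real.norm_two]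
    exact mul_le_mul_of_nonneg_left (le_max_left _ _) (by positivity)
  · calc ‖p.2‖ ≤ 1 * max ‖p.1‖ ‖p.2‖ := by rw [one_mul]; exact le_max_right _ _
      _ ≤ 2 ^ k * max ‖p.1‖ ‖p.2‖ := by gcongr

/-- The linear map `(t, x) ↦ 2^k t / δ`. [folklore] -/
def heightScale (δ : ℝ) (k : ℕ) : ℝ × E' →L[ℝ] ℝ := (2 ^ k / δ) • ContinuousLinearMap.fst ℝ ℝ E'

/-- `(t, x) ↦ 2^k t / δ`, pointwise. [folklore] -/
@[simp] theorem heightScale_apply (δ : ℝ) (k : ℕ) (p : ℝ × E') :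
    heightScale δ k p = 2 ^ k * p.1 / δ := by
  simp [heightScale]; ring

/-- `‖(t, x) ↦ 2^k t / δ‖ ≤ 2^k / δ`. [folklore] -/
theorem norm_heightScale_le {δ : ℝ} (hδ : 0 < δ) (k : ℕ) :
    ‖(heightScale δ k : ℝ × E' →L[ℝ] ℝ)‖ ≤ 2 ^ k / δ := by
  refine ContinuousLinearMap.opNorm_le_bound _ (by positivity) fun p => ?_
  rw [heightScale_apply, Prod.norm_def]
  rw [show 2 ^ k * p.1 / δ = (2 ^ k / δ) * p.1 by ring, norm_mul, Real.norm_of_nonneg (by positivity)]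
  exact mul_le_mul_of_nonneg_left (le_max_left _ _) (by positivity)

/-- The weight as a function on `ℝ × E'` is `a_k • (cutoff ∘ heightScale)`. [folklore] -/
theorem weight_comp_fst (δ : ℝ) (k : ℕ) :
    (fun p : ℝ × E' => weight δ k p.1) =
      fun p => coeff k • (cutoff ∘ (heightScale δ k : ℝ × E' →L[ℝ] ℝ)) p := by
  funext p; simp [weight, smul_eq_mul]

/-- **Bound for the derivatives of the weights**: `‖Dⁱ w_k‖ ≤ |a_k| C_i (2^k/δ)^i`. [folklore] -/
theorem norm_iteratedFDeriv_weight_le {δ : ℝ} (hδ : 0 < δ) (k i : ℕ) (p : ℝ × E') :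
    ‖iteratedFDeriv ℝ i (fun q : ℝ × E' => weight δ k q.1) p‖ ≤
      |coeff k| * cutoffBound i * (2 ^ k / δ) ^ i := by
  have hcut : ContDiff ℝ ∞ cutoff := contDiff_cutoff
  have hcut' : ContDiff ℝ i cutoff := contDiff_cutoff
  have hcd : ContDiffAt ℝ i (cutoff ∘ (heightScale δ k : ℝ × E' →L[ℝ] ℝ)) p :=
    (hcut'.comp (heightScale (E' := E') δ k).contDiff).contDiffAt
  rw [weight_comp_fst, iteratedFDeriv_const_smul_apply' (a := coeff k) hcd, norm_smul, Real.norm_eq_abs,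
    mul_assoc]
  refine mul_le_mul_of_nonneg_left ?_ (abs_nonneg _)
  rw [(heightScale (E' := E') δ k).iteratedFDeriv_comp_right hcut p (by exact_mod_cast le_top)]
  refine (ContinuousMultilinearMap.norm_compContinuousLinearMap_le _ _).trans ?_
  rw [Finset.prod_const, Finset.card_univ, Fintype.card_fin]
  exact mul_le_mul (norm_iteratedFDeriv_cutoff_le i _) (pow_le_pow_left₀ (norm_nonneg _)
    (norm_heightScale_le hδ k) i) (by positivity) (cutoffBound_nonneg i)

variable {δ : ℝ} (hδ : 0 < δ) {f : ℝ × E' → F} {B : Set E'} (hB : IsOpen B)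

/-- The closed-below slab `[0, δ) × B` on which `f` is given. [folklore] -/
def slab (δ : ℝ) (B : Set E') : Set (ℝ × E') := Set.Ico 0 δ ×ˢ B

omit hδ in
/-- Derivatives within the slab are unique (it is a product of convex sets with nonempty interior). [folklore] -/
theorem uniqueDiffOn_slab (hB : IsOpen B) : UniqueDiffOn ℝ (slab δ B) :=
  UniqueDiffOn.prod (uniqueDiffOn_Ico 0 δ) hB.uniqueDiffOn

include hδ in
/-- For `t < 0` with `2^k t / δ > -1`, the point `A_k (t, x)` lies in the open slab. [folklore] -/
theorem scale_mem_Ioo {k : ℕ} {p : ℝ × E'} (hp1 : p.1 < 0) (hp2 : p.2 ∈ B)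
    (h : -1 < 2 ^ k * p.1 / δ) : scale k p ∈ Set.Ioo 0 δ ×ˢ B := by
  have h2k : (0 : ℝ) < 2 ^ k := by positivity
  refine ⟨⟨?_, ?_⟩, by simpa using hp2⟩
  · simp only [scale_apply]; nlinarith
  · simp only [scale_apply]
    rw [lt_div_iff₀ hδ] at h; nlinarith

omit hδ in
/-- The open slab lies in the slab. [folklore] -/
theorem Ioo_subset_slab {E' : Type*} {δ : ℝ} {B : Set E'} : Set.Ioo 0 δ ×ˢ B ⊆ slab δ B :=
  Set.prod_mono Set.Ioo_subset_Ico_self le_rfl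

include hB in
/-- At interior points the derivatives within the slab are the derivatives. [folklore] -/
theorem iteratedFDerivWithin_slab_eq (hf : ContDiffOn ℝ ∞ f (slab δ B)) {q : ℝ × E'}
    (hq : q ∈ Set.Ioo 0 δ ×ˢ B) (m : ℕ) :
    iteratedFDerivWithin ℝ m f (slab δ B) q = iteratedFDeriv ℝ m f q := by
  have hn : slab δ B ∈ 𝓝 q := Filter.mem_of_superset ((isOpen_Ioo.prod hB).mem_nhds hq) Ioo_subset_slab
  exact iteratedFDerivWithin_eq_iteratedFDeriv (uniqueDiffOn_slab hB)
    ((hf.contDiffAt hn).of_le (by exact_mod_cast le_top)) (Ioo_subset_slab hq)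

include hδ hB in
/-- **The derivatives of `f ∘ A_k` below the hyperplane**: for `t < 0` with `2^k t / δ > -1`,
`Dᵐ (f ∘ A_k) (t, x) = (Dᵐ f) (A_k (t, x)) ∘ A_k^{⊗m}` (derivatives of `f` within the slab). [folklore] -/
theorem iteratedFDeriv_comp_scale (hf : ContDiffOn ℝ ∞ f (slab δ B)) {k : ℕ} {p : ℝ × E'}
    (hp1 : p.1 < 0) (hp2 : p.2 ∈ B) (h : -1 < 2 ^ k * p.1 / δ) (m : ℕ) :
    iteratedFDeriv ℝ m (f ∘ scale k) p =
      (iteratedFDerivWithin ℝ m f (slab δ B) (scale k p)).compContinuousLinearMap fun _ => scale k := by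
  have hmem := scale_mem_Ioo hδ hp1 hp2 h
  set O : Set (ℝ × E') := Set.Ioo 0 δ ×ˢ B with hO
  have hOo : IsOpen O := isOpen_Ioo.prod hB
  have hpre : IsOpen ((scale k) ⁻¹' O) := hOo.preimage (scale k).continuous
  have h1 := (scale k).iteratedFDerivWithin_comp_right (f := f) (hf.mono Ioo_subset_slab)
    hOo.uniqueDiffOn hpre.uniqueDiffOn (x := p) hmem (i := m) (by exact_mod_cast le_top)
  rw [iteratedFDerivWithin_of_isOpen m hpre (Set.mem_preimage.2 hmem),
    iteratedFDerivWithin_of_isOpen m hOo hmem] at h1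
  rw [h1, iteratedFDerivWithin_slab_eq hB hf hmem]

include hδ hB in
/-- **Bound for the derivatives of `f ∘ A_k`**: `‖Dʲ (f ∘ A_k) (t, x)‖ ≤ ‖Dʲ f (A_k (t,x))‖ 2^{kj}`. [folklore] -/
theorem norm_iteratedFDeriv_comp_scale_le (hf : ContDiffOn ℝ ∞ f (slab δ B)) {k : ℕ} {p : ℝ × E'}
    (hp1 : p.1 < 0) (hp2 : p.2 ∈ B) (h : -1 < 2 ^ k * p.1 / δ) (j : ℕ) :
    ‖iteratedFDeriv ℝ j (f ∘ scale k) p‖ ≤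
      ‖iteratedFDerivWithin ℝ j f (slab δ B) (scale k p)‖ * (2 ^ k) ^ j := by
  rw [iteratedFDeriv_comp_scale hδ hB hf hp1 hp2 h]
  refine (ContinuousMultilinearMap.norm_compContinuousLinearMap_le _ _).trans ?_
  rw [Finset.prod_const, Finset.card_univ, Fintype.card_fin]
  exact mul_le_mul_of_nonneg_left (pow_le_pow_left₀ (norm_nonneg _) (norm_scale_le k) j)
    (norm_nonneg _)

/-! ### The zones: far below, the transition zone, and near the hyperplane -/

/-- **The main part** of the `m`-th derivative of the `k`-th term:
`w_k(t) • (Dᵐ f)(A_k (t,x)) ∘ A_k^{⊗m}` (no derivative falls on the cutoff). [folklore] -/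
def mainPart (δ : ℝ) (f : ℝ × E' → F) (B : Set E') (m k : ℕ) (p : ℝ × E') :
    ContinuousMultilinearMap ℝ (fun _ : Fin m => ℝ × E') F :=
  weight δ k p.1 •
    (iteratedFDerivWithin ℝ m f (slab δ B) (scale k p)).compContinuousLinearMap fun _ => scale k

omit hδ in
/-- Far below (`2^k t / δ < -1/2`) the `k`-th term vanishes identically near the point, so all
its derivatives vanish. [folklore] -/
theorem iteratedFDeriv_term_of_lt {k : ℕ} {p : ℝ × E'} (h : 2 ^ k * p.1 / δ < -1 / 2) (m : ℕ) :
    iteratedFDeriv ℝ m (term δ f k) p = 0 := by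
  have hev : term δ f k =ᶠ[𝓝 p] fun _ => (0 : F) := by
    have ho : IsOpen {q : ℝ × E' | 2 ^ k * q.1 / δ < -1 / 2} :=
      isOpen_lt ((continuous_const.mul continuous_fst).div_const _) continuous_const
    filter_upwards [ho.mem_nhds h] with q hq
    rw [term, weight_eq_zero (le_of_lt hq), zero_smul]
  rw [(hev.iteratedFDeriv ℝ m).eq_of_nhds, iteratedFDeriv_fun_zero, Pi.zero_apply]

omit hδ in
/-- Far below, the main part vanishes (the weight does). [folklore] -/
theorem mainPart_of_lt {k : ℕ} {p : ℝ × E'} (h : 2 ^ k * p.1 / δ < -1 / 2) (m : ℕ) :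
    mainPart δ f B m k p = 0 := by
  rw [mainPart, weight_eq_zero h.le, zero_smul]

include hδ hB in
/-- Near the hyperplane (`2^k t / δ > -1/4`, `t < 0`) the cutoff is `1` near the point, so the
derivative of the `k`-th term is its main part. [folklore] -/
theorem iteratedFDeriv_term_of_gt (hf : ContDiffOn ℝ ∞ f (slab δ B)) {k : ℕ} {p : ℝ × E'}
    (hp1 : p.1 < 0) (hp2 : p.2 ∈ B) (h : -1 / 4 < 2 ^ k * p.1 / δ) (m : ℕ) :
    iteratedFDeriv ℝ m (term δ f k) p = mainPart δ f B m k p := by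
  have h' : -1 < 2 ^ k * p.1 / δ := by linarith
  have hev : term δ f k =ᶠ[𝓝 p] fun q => coeff k • (f ∘ scale k) q := by
    have ho : IsOpen {q : ℝ × E' | -1 / 4 < 2 ^ k * q.1 / δ} :=
      isOpen_lt continuous_const ((continuous_const.mul continuous_fst).div_const _)
    filter_upwards [ho.mem_nhds h] with q hq
    rw [term, weight_eq_coeff (le_of_lt hq)]
    rfl
  have hcd : ContDiffAt ℝ m (f ∘ scale k) p := by
    have hmem := scale_mem_Ioo hδ hp1 hp2 h'
    have : ContDiffAt ℝ ∞ f (scale k p) :=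
      hf.contDiffAt (Filter.mem_of_superset ((isOpen_Ioo.prod hB).mem_nhds hmem) Ioo_subset_slab)
    exact (this.of_le (by exact_mod_cast le_top)).comp p
      ((scale k : ℝ × E' →L[ℝ] ℝ × E').contDiff (n := (m : ℕ∞ω))).contDiffAt
  rw [(hev.iteratedFDeriv ℝ m).eq_of_nhds, iteratedFDeriv_const_smul_apply' hcd,
    iteratedFDeriv_comp_scale hδ hB hf hp1 hp2 h', mainPart, weight_eq_coeff h.le]

/-- The open set below the hyperplane on which the `k`-th term is a product of smooth factors. [folklore] -/
def zone (δ : ℝ) (B : Set E') (k : ℕ) : Set (ℝ × E') :=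
  {q | q.1 < 0 ∧ q.2 ∈ B ∧ -1 < 2 ^ k * q.1 / δ}

omit [NormedSpace ℝ E'] hδ in
include hB in
/-- The zone is open. [folklore] -/
theorem isOpen_zone (k : ℕ) : IsOpen (zone δ B k) := by
  refine (isOpen_lt continuous_fst continuous_const).inter ((hB.preimage continuous_snd).inter ?_)
  exact isOpen_lt continuous_const ((continuous_const.mul continuous_fst).div_const _)

include hδ hB in
/-- `f ∘ A_k` is smooth on the zone. [folklore] -/
theorem contDiffOn_comp_scale_zone (hf : ContDiffOn ℝ ∞ f (slab δ B)) (k : ℕ) :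
    ContDiffOn ℝ ∞ (f ∘ scale k) (zone δ B k) := by
  rintro p ⟨hp1, hp2, h⟩
  have hmem := scale_mem_Ioo hδ hp1 hp2 h
  have : ContDiffAt ℝ ∞ f (scale k p) :=
    hf.contDiffAt (Filter.mem_of_superset ((isOpen_Ioo.prod hB).mem_nhds hmem) Ioo_subset_slab)
  exact (this.comp p ((scale k : ℝ × E' →L[ℝ] ℝ × E').contDiff (n := ∞)).contDiffAt).contDiffWithinAt

include hδ hB in
/-- **The Leibniz bound for the derivatives of the `k`-th term** below the hyperplane:
`‖Dᵐ (w_k • f ∘ A_k)‖ ≤ |a_k| ∑ᵢ C(m,i) Cᵢ (2^k/δ)ⁱ ‖D^{m-i} f (A_k ·)‖ 2^{k(m-i)}`. [folklore] -/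
theorem norm_iteratedFDeriv_term_le (hf : ContDiffOn ℝ ∞ f (slab δ B)) {k : ℕ} {p : ℝ × E'}
    (hp1 : p.1 < 0) (hp2 : p.2 ∈ B) (h : -1 < 2 ^ k * p.1 / δ) (m : ℕ) :
    ‖iteratedFDeriv ℝ m (term δ f k) p‖ ≤
      |coeff k| * ∑ i ∈ Finset.range (m + 1), (m.choose i : ℝ) * (cutoffBound i * (2 ^ k / δ) ^ i) *
        (‖iteratedFDerivWithin ℝ (m - i) f (slab δ B) (scale k p)‖ * (2 ^ k) ^ (m - i)) := by
  have hz : p ∈ zone δ B k := ⟨hp1, hp2, h⟩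
  have ho := isOpen_zone (δ := δ) hB k
  have hw : ContDiffOn ℝ ∞ (fun q : ℝ × E' => weight δ k q.1) (zone δ B k) :=
    ((contDiff_weight δ k).comp contDiff_fst).contDiffOn
  have hg := contDiffOn_comp_scale_zone hδ hB hf k
  have hL := norm_iteratedFDerivWithin_smul_le (𝕜 := ℝ) hw hg ho.uniqueDiffOn hz (n := m)
    (by exact_mod_cast le_top)
  -- the term is the product
  have hterm : (fun y => weight δ k y.1 • (f ∘ scale k) y) = term δ f k := by
    funext y; rfl
  rw [hterm, iteratedFDerivWithin_of_isOpen m ho hz] at hL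
  refine hL.trans ?_
  rw [Finset.mul_sum]
  refine Finset.sum_le_sum fun i hi => ?_
  rw [iteratedFDerivWithin_of_isOpen i ho hz, iteratedFDerivWithin_of_isOpen (m - i) ho hz]
  have h1 := norm_iteratedFDeriv_weight_le (E' := E') hδ k i p
  have h2 := norm_iteratedFDeriv_comp_scale_le hδ hB hf hp1 hp2 h (m - i)
  have h3 : (0 : ℝ) ≤ m.choose i := by positivity
  have h4 : (0 : ℝ) ≤ |coeff k| * cutoffBound i * (2 ^ k / δ) ^ i := by
    have := cutoffBound_nonneg i; positivity
  calc (m.choose i : ℝ) * ‖iteratedFDeriv ℝ i (fun q : ℝ × E' => weight δ k q.1) p‖ *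
        ‖iteratedFDeriv ℝ (m - i) (f ∘ scale k) p‖
      ≤ (m.choose i : ℝ) * (|coeff k| * cutoffBound i * (2 ^ k / δ) ^ i) *
        (‖iteratedFDerivWithin ℝ (m - i) f (slab δ B) (scale k p)‖ * (2 ^ k) ^ (m - i)) := by
        gcongr
    _ = |coeff k| * ((m.choose i : ℝ) * (cutoffBound i * (2 ^ k / δ) ^ i) *
        (‖iteratedFDerivWithin ℝ (m - i) f (slab δ B) (scale k p)‖ * (2 ^ k) ^ (m - i))) := by ring

include hδ in
/-- In the support of the weight the height of `A_k (t, x)` is at most `δ / 2`. [folklore] -/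
theorem scale_fst_le_of_weight_ne_zero {k : ℕ} {p : ℝ × E'} (hw : -1 / 2 < 2 ^ k * p.1 / δ) :
    (scale k p).1 ≤ δ / 2 := by
  simp only [scale_apply]
  rw [lt_div_iff₀ hδ] at hw
  linarith

end TermBounds

section Limit

variable {E' F : Type*} [NormedAddCommGroup E'] [NormedSpace ℝ E'] [NormedAddCommGroup F]
  [NormedSpace ℝ F]
  {δ : ℝ} (hδ : 0 < δ) {f : ℝ × E' → F} {B : Set E'} (hB : IsOpen B)

/-! ### The derivatives of the extension below the hyperplane, termwise -/

include hδ hB in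
/-- **Termwise differentiation**: below the hyperplane the `m`-th derivative of Seeley's extension
is the (locally finite) sum of the `m`-th derivatives of the terms. [folklore] -/
theorem hasSum_iteratedFDeriv_term (hf : ContDiffOn ℝ ∞ f (slab δ B)) {p : ℝ × E'}
    (hp1 : p.1 < 0) (hp2 : p.2 ∈ B) (m : ℕ) :
    HasSum (fun k => iteratedFDeriv ℝ m (term δ f k) p)
      (iteratedFDerivWithin ℝ m (extend δ f) (Set.Iio 0 ×ˢ B) p) := by
  obtain ⟨K, hK⟩ : ∃ K : ℕ, δ / (-p.1) ≤ 2 ^ K :=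
    (pow_unbounded_of_one_lt (δ / (-p.1)) (by norm_num : (1 : ℝ) < 2)).imp fun _ h => h.le
  have hL : IsOpen (Set.Iio (0 : ℝ) ×ˢ B) := isOpen_Iio.prod hB
  have hpL : p ∈ Set.Iio (0 : ℝ) ×ˢ B := ⟨hp1, hp2⟩
  -- for `k ≥ K` the `k`-th term vanishes near `p`
  have hfar : ∀ k, K ≤ k → 2 ^ k * p.1 / δ < -1 / 2 := by
    intro k hk
    have h1 : δ ≤ 2 ^ k * (-p.1) := by
      have := hK.trans (pow_le_pow_right₀ (by norm_num : (1 : ℝ) ≤ 2) hk)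
      rwa [div_le_iff₀ (by linarith)] at this
    rw [div_lt_iff₀ hδ]; nlinarith
  have hzero : ∀ k ∉ range K, iteratedFDeriv ℝ m (term δ f k) p = 0 := fun k hk =>
    iteratedFDeriv_term_of_lt (hfar k (not_lt.1 fun h' => hk (mem_range.2 h'))) m
  suffices hval : iteratedFDerivWithin ℝ m (extend δ f) (Set.Iio 0 ×ˢ B) p =
      ∑ k ∈ range K, iteratedFDeriv ℝ m (term δ f k) p by
    rw [hval]; exact hasSum_sum_of_ne_finset_zero hzero
  -- near `p` the extension is the finite sum
  have hV : Set.Iio (p.1 / 2) ×ˢ B ∈ 𝓝 p :=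
    (isOpen_Iio.prod hB).mem_nhds ⟨by simp only [Set.mem_Iio]; linarith, hp2⟩
  have heq : extend δ f =ᶠ[𝓝 p] fun q => ∑ k ∈ range K, term δ f k q := by
    filter_upwards [hV] with q hq
    exact extend_eq_sum_of_lt hδ hp1 hK hq.1
  have hterms : ∀ k ∈ range K, ContDiffWithinAt ℝ m (term δ f k) Set.univ p := fun k _ =>
    ((contDiffAt_term hδ hB (hf.mono Ioo_subset_slab) k hp1 hp2).of_le
      (by exact_mod_cast le_top)).contDiffWithinAt
  rw [iteratedFDerivWithin_of_isOpen m hL hpL, (heq.iteratedFDeriv ℝ m).eq_of_nhds,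
    ← iteratedFDerivWithin_univ]
  have hsum := iteratedFDerivWithin_sum_apply (𝕜 := ℝ) (f := fun k => term δ f k) (u := range K)
    (i := m) (x := p) uniqueDiffOn_univ (Set.mem_univ _) hterms
  rw [Finset.sum_fn] at hsum
  rw [hsum]
  simp only [iteratedFDerivWithin_univ]

/-! ### Uniform bounds for the derivatives of `f` near a compact segment -/

include hδ hB in
/-- The derivatives of `f` of order `≤ m` are bounded near the compact segment
`[0, δ/2] × {x₀}` of the slab. [folklore] -/
theorem exists_bound_iteratedFDerivWithin (hf : ContDiffOn ℝ ∞ f (slab δ B)) {x₀ : E'} (hx₀ : x₀ ∈ B)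
    (m : ℕ) : ∃ W : Set E', IsOpen W ∧ x₀ ∈ W ∧ ∃ N : ℝ, 0 ≤ N ∧
      ∀ j ≤ m, ∀ q ∈ slab δ B, q.1 ≤ δ / 2 → q.2 ∈ W →
        ‖iteratedFDerivWithin ℝ j f (slab δ B) q‖ ≤ N := by
  set g : ℝ × E' → ℝ := fun q => ∑ j ∈ range (m + 1), ‖iteratedFDerivWithin ℝ j f (slab δ B) q‖
    with hg
  have hgc : ContinuousOn g (slab δ B) :=
    continuousOn_finsetSum _ fun j _ =>
      (hf.continuousOn_iteratedFDerivWithin (by exact_mod_cast le_top) (uniqueDiffOn_slab hB)).norm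
  set K : Set (ℝ × E') := Set.Icc 0 (δ / 2) ×ˢ {x₀} with hK
  have hKc : IsCompact K := isCompact_Icc.prod isCompact_singleton
  have hKs : K ⊆ slab δ B := by
    rintro ⟨t, x⟩ ⟨⟨ht0, ht1⟩, hx⟩
    rw [Set.mem_singleton_iff] at hx; subst hx
    exact ⟨⟨ht0, by linarith⟩, hx₀⟩
  obtain ⟨N₀, hN₀⟩ := hKc.exists_bound_of_continuousOn (hgc.mono hKs)
  -- an open set on which `g < N₀ + 1`
  obtain ⟨U, hUo, hU⟩ := (continuousOn_iff'.1 hgc) (Set.Iio (N₀ + 1)) isOpen_Iio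
  have hKU : K ⊆ U := fun q hq => by
    have hq' : q ∈ g ⁻¹' Set.Iio (N₀ + 1) ∩ slab δ B := by
      refine ⟨?_, hKs hq⟩
      have h1 := hN₀ q hq
      rw [Real.norm_eq_abs] at h1
      exact lt_of_le_of_lt ((le_abs_self _).trans h1) (lt_add_one _)
    rw [hU] at hq'; exact hq'.1
  obtain ⟨V, W, hVo, hWo, hV, hW, hVW⟩ := generalized_tube_lemma isCompact_Icc isCompact_singleton
    hUo hKU
  refine ⟨W, hWo, hW (Set.mem_singleton x₀), N₀ + 1, ?_, fun j hj q hq hq1 hq2 => ?_⟩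
  · have := hN₀ _ (show ((0 : ℝ), x₀) ∈ K from ⟨⟨le_rfl, by linarith⟩, Set.mem_singleton x₀⟩)
    linarith [norm_nonneg (g (0, x₀))]
  · have hqU : q ∈ U := hVW (Set.mk_mem_prod (hV ⟨hq.1.1, hq1⟩) hq2)
    have hqg : q ∈ g ⁻¹' Set.Iio (N₀ + 1) ∩ slab δ B := by rw [hU]; exact ⟨hqU, hq⟩
    have hlt : g q < N₀ + 1 := hqg.1
    refine le_trans ?_ hlt.le
    exact Finset.single_le_sum (f := fun j => ‖iteratedFDerivWithin ℝ j f (slab δ B) q‖)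
      (fun _ _ => norm_nonneg _) (mem_range.2 (Nat.lt_succ_of_le hj))

/-! ### The limit of the derivatives at the hyperplane -/

/-- The remainder `R_k = Dᵐ(term_k) - mainPart_k` (derivatives falling on the cutoff). [folklore] -/
def remainder (δ : ℝ) (f : ℝ × E' → F) (B : Set E') (m k : ℕ) (p : ℝ × E') :
    ContinuousMultilinearMap ℝ (fun _ : Fin m => ℝ × E') F :=
  iteratedFDeriv ℝ m (term δ f k) p - mainPart δ f B m k p

include hδ hB in
/-- The remainder is supported in the transition zone `-1/2 ≤ 2^k t / δ ≤ -1/4`. [folklore] -/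
theorem remainder_eq_zero (hf : ContDiffOn ℝ ∞ f (slab δ B)) {k : ℕ} {p : ℝ × E'}
    (hp1 : p.1 < 0) (hp2 : p.2 ∈ B)
    (h : 2 ^ k * p.1 / δ < -1 / 2 ∨ -1 / 4 < 2 ^ k * p.1 / δ) (m : ℕ) :
    remainder δ f B m k p = 0 := by
  rcases h with h | h
  · rw [remainder, iteratedFDeriv_term_of_lt h, mainPart_of_lt h, sub_zero]
  · rw [remainder, iteratedFDeriv_term_of_gt hδ hB hf hp1 hp2 h, sub_self]

/-- The constant `K_m = ∑ᵢ C(m,i) Cᵢ / δⁱ` of the Leibniz bound. [folklore] -/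
def leibnizConst (δ : ℝ) (m : ℕ) : ℝ := ∑ i ∈ range (m + 1), (m.choose i : ℝ) * cutoffBound i / δ ^ i

omit hδ in
/-- The Leibniz constant is nonnegative. [folklore] -/
theorem leibnizConst_nonneg (hδ : 0 < δ) (m : ℕ) : 0 ≤ leibnizConst δ m :=
  Finset.sum_nonneg fun i _ => by have := cutoffBound_nonneg i; positivity

include hδ hB in
/-- **Bound for the derivatives of the terms from a uniform bound `N` for the derivatives of
`f`**: `‖Dᵐ term_k‖ ≤ |a_k| 2^{km} N K_m` (below the hyperplane, where `2^k t / δ > -1`). [folklore] -/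
theorem norm_iteratedFDeriv_term_le_of_bound (hf : ContDiffOn ℝ ∞ f (slab δ B)) {m : ℕ} {N : ℝ}
    {k : ℕ} {p : ℝ × E'} (hp1 : p.1 < 0) (hp2 : p.2 ∈ B) (h : -1 < 2 ^ k * p.1 / δ)
    (hN : ∀ j ≤ m, ‖iteratedFDerivWithin ℝ j f (slab δ B) (scale k p)‖ ≤ N) :
    ‖iteratedFDeriv ℝ m (term δ f k) p‖ ≤ |coeff k| * (2 ^ k) ^ m * N * leibnizConst δ m := by
  refine (norm_iteratedFDeriv_term_le hδ hB hf hp1 hp2 h m).trans ?_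
  rw [leibnizConst, Finset.mul_sum, Finset.mul_sum]
  refine Finset.sum_le_sum fun i hi => ?_
  have him : i ≤ m := Nat.lt_succ_iff.1 (mem_range.1 hi)
  have hNi := hN (m - i) (Nat.sub_le m i)
  have hN0 : 0 ≤ N := (norm_nonneg _).trans (hN 0 (Nat.zero_le m))
  have hC := cutoffBound_nonneg i
  have hpow : (2 ^ k / δ) ^ i * (2 ^ k : ℝ) ^ (m - i) = (2 ^ k) ^ m / δ ^ i := by
    rw [div_pow, div_mul_eq_mul_div, ← pow_add, Nat.add_sub_cancel' him]
  calc |coeff k| * ((m.choose i : ℝ) * (cutoffBound i * (2 ^ k / δ) ^ i) *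
        (‖iteratedFDerivWithin ℝ (m - i) f (slab δ B) (scale k p)‖ * (2 ^ k) ^ (m - i)))
      ≤ |coeff k| * ((m.choose i : ℝ) * (cutoffBound i * (2 ^ k / δ) ^ i) * (N * (2 ^ k) ^ (m - i))) := by
        gcongr
    _ = |coeff k| * (2 ^ k) ^ m * N * ((m.choose i : ℝ) * cutoffBound i / δ ^ i) := by
        rw [show (m.choose i : ℝ) * (cutoffBound i * (2 ^ k / δ) ^ i) * (N * (2 ^ k) ^ (m - i)) =
          (m.choose i : ℝ) * cutoffBound i * N * ((2 ^ k / δ) ^ i * (2 ^ k) ^ (m - i)) by ring, hpow]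
        ring

omit hδ hB in
/-- **Bound for the main parts**: `‖mainPart_k‖ ≤ |a_k| 2^{km} N`, given a bound `N` for `Dᵐ f` at
`A_k (t, x)` whenever the weight does not vanish. [folklore] -/
theorem norm_mainPart_le {m : ℕ} {N : ℝ} (hN0 : 0 ≤ N) {k : ℕ} {p : ℝ × E'}
    (hN : -1 / 2 < 2 ^ k * p.1 / δ → ‖iteratedFDerivWithin ℝ m f (slab δ B) (scale k p)‖ ≤ N) :
    ‖mainPart δ f B m k p‖ ≤ |coeff k| * (2 ^ k) ^ m * N := by
  by_cases h : -1 / 2 < 2 ^ k * p.1 / δ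
  · rw [mainPart, norm_smul, Real.norm_eq_abs]
    have h1 : ‖(iteratedFDerivWithin ℝ m f (slab δ B) (scale k p)).compContinuousLinearMap
        fun _ => scale k‖ ≤ N * (2 ^ k) ^ m := by
      refine (ContinuousMultilinearMap.norm_compContinuousLinearMap_le _ _).trans ?_
      rw [Finset.prod_const, Finset.card_univ, Fintype.card_fin]
      exact mul_le_mul (hN h) (pow_le_pow_left₀ (norm_nonneg _) (norm_scale_le k) m)
        (by positivity) hN0
    calc |weight δ k p.1| * ‖(iteratedFDerivWithin ℝ m f (slab δ B) (scale k p)).compContinuousLinearMap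
          fun _ => scale k‖ ≤ |coeff k| * (N * (2 ^ k) ^ m) :=
          mul_le_mul (abs_weight_le δ k p.1) h1 (norm_nonneg _) (abs_nonneg _)
      _ = |coeff k| * (2 ^ k) ^ m * N := by ring
  · have h' : 2 ^ k * p.1 / δ ≤ -1 / 2 := not_lt.1 h
    rw [mainPart, weight_eq_zero h', zero_smul, norm_zero]
    positivity

include hδ hB in
/-- **Domination of the remainders**: `‖R_k‖ ≤ |a_k| 2^{km} N (K_m + 1)` below the hyperplane, for
points whose second coordinate lies in the set `W` of a uniform bound `N` and with `-δ/2 < t`. [folklore] -/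
theorem norm_remainder_le (hf : ContDiffOn ℝ ∞ f (slab δ B)) {m : ℕ} {N : ℝ} (hN0 : 0 ≤ N)
    {W : Set E'} (hN : ∀ j ≤ m, ∀ q ∈ slab δ B, q.1 ≤ δ / 2 → q.2 ∈ W →
      ‖iteratedFDerivWithin ℝ j f (slab δ B) q‖ ≤ N)
    {k : ℕ} {p : ℝ × E'} (hp1 : p.1 < 0) (hp2 : p.2 ∈ B) (hpW : p.2 ∈ W) :
    ‖remainder δ f B m k p‖ ≤ |coeff k| * (2 ^ k) ^ m * N * (leibnizConst δ m + 1) := by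
  by_cases hz : 2 ^ k * p.1 / δ < -1 / 2 ∨ -1 / 4 < 2 ^ k * p.1 / δ
  · rw [remainder_eq_zero hδ hB hf hp1 hp2 hz, norm_zero]
    have := leibnizConst_nonneg hδ m; positivity
  · rw [not_or, not_lt, not_lt] at hz
    obtain ⟨hz1, hz2⟩ := hz
    have h1 : -1 < 2 ^ k * p.1 / δ := by linarith
    have hmem : scale k p ∈ slab δ B := Ioo_subset_slab (scale_mem_Ioo hδ hp1 hp2 h1)
    have hle : (scale k p).1 ≤ δ / 2 := by
      simp only [scale_apply]; rw [le_div_iff₀ hδ] at hz1; linarith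
    have hNk : ∀ j ≤ m, ‖iteratedFDerivWithin ℝ j f (slab δ B) (scale k p)‖ ≤ N := fun j hj =>
      hN j hj _ hmem hle (by simpa using hpW)
    rw [remainder]
    refine (norm_sub_le _ _).trans ?_
    have hT := norm_iteratedFDeriv_term_le_of_bound hδ hB hf hp1 hp2 h1 hNk
    have hM := norm_mainPart_le (f := f) (B := B) (δ := δ) hN0 (k := k) (p := p) (m := m)
      fun _ => hNk m le_rfl
    calc ‖iteratedFDeriv ℝ m (term δ f k) p‖ + ‖mainPart δ f B m k p‖
        ≤ |coeff k| * (2 ^ k) ^ m * N * leibnizConst δ m + |coeff k| * (2 ^ k) ^ m * N := add_le_add hT hM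
      _ = |coeff k| * (2 ^ k) ^ m * N * (leibnizConst δ m + 1) := by ring

/-- The dominating sequence `|a_k| 2^{km} C` is summable. [folklore] -/
theorem summable_abs_coeff_mul_pow_mul (m : ℕ) (C : ℝ) :
    Summable fun k => |coeff k| * ((2 : ℝ) ^ k) ^ m * C := by
  have h := (summable_abs_coeff_mul_pow m).mul_right C
  refine h.congr fun k => ?_
  rw [← pow_mul]

variable [CompleteSpace F]

include hδ hB in
/-- **The derivatives of Seeley's extension tend, at the hyperplane, to the one-sided derivatives
of `f`**: for every `m` and `x₀ ∈ B`,
`Dᵐ (E f) (t, x) → (Dᵐ f)(0, x₀)` as `(t, x) → (0, x₀)`, `t < 0`, where `Dᵐ f` is the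
derivative of `f` within the slab `[0, δ) × B`. [folklore] -/
theorem tendsto_iteratedFDerivWithin_extend (hf : ContDiffOn ℝ ∞ f (slab δ B)) {x₀ : E'}
    (hx₀ : x₀ ∈ B) (m : ℕ) :
    Tendsto (fun p => iteratedFDerivWithin ℝ m (extend δ f) (Set.Iio 0 ×ˢ B) p)
      (𝓝[Set.Iio 0 ×ˢ B] (0, x₀)) (𝓝 (iteratedFDerivWithin ℝ m f (slab δ B) (0, x₀))) := by
  obtain ⟨W, hWo, hxW, N, hN0, hN⟩ := exists_bound_iteratedFDerivWithin hδ hB hf hx₀ m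
  set l := 𝓝[Set.Iio (0 : ℝ) ×ˢ B] ((0 : ℝ), x₀) with hl
  set L := Set.Iio (0 : ℝ) ×ˢ B with hL
  -- eventually `p ∈ L`, `p.2 ∈ W`
  have hev : ∀ᶠ p in l, p ∈ L ∧ p.2 ∈ W := by
    refine Filter.inter_mem self_mem_nhdsWithin ?_
    exact mem_nhdsWithin_of_mem_nhds ((hWo.preimage continuous_snd).mem_nhds hxW)
  -- the decomposition `Dᵐ (E f) = ∑ main + ∑ R`
  have hfin_main : ∀ p ∈ L, ∀ K : ℕ, δ / (-p.1) ≤ 2 ^ K →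
      ∀ k ∉ range K, mainPart δ f B m k p = 0 := by
    intro p hp K hK k hk
    have hk' : K ≤ k := not_lt.1 fun h' => hk (mem_range.2 h')
    apply mainPart_of_lt
    have h1 : δ ≤ 2 ^ k * (-p.1) := by
      have := hK.trans (pow_le_pow_right₀ (by norm_num : (1 : ℝ) ≤ 2) hk')
      rwa [div_le_iff₀ (by have := hp.1; simp only [Set.mem_Iio] at this; linarith)] at this
    rw [div_lt_iff₀ hδ]; nlinarith
  have hdecomp : ∀ p ∈ L, iteratedFDerivWithin ℝ m (extend δ f) L p =
      (∑' k, mainPart δ f B m k p) + ∑' k, remainder δ f B m k p := by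
    intro p hp
    obtain ⟨K, hK⟩ : ∃ K : ℕ, δ / (-p.1) ≤ 2 ^ K :=
      (pow_unbounded_of_one_lt (δ / (-p.1)) (by norm_num : (1 : ℝ) < 2)).imp fun _ h => h.le
    have h1 := hasSum_iteratedFDeriv_term hδ hB hf (p := p) hp.1 hp.2 m
    have hsm : Summable fun k => mainPart δ f B m k p :=
      summable_of_ne_finset_zero (hfin_main p hp K hK)
    have hsr : Summable fun k => remainder δ f B m k p := by
      have : (fun k => remainder δ f B m k p) =
          fun k => iteratedFDeriv ℝ m (term δ f k) p - mainPart δ f B m k p := rfl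
      rw [this]
      exact h1.summable.sub hsm
    rw [← h1.tsum_eq, ← hsm.tsum_add hsr]
    congr 1; funext k; rw [remainder, add_sub_cancel]
  -- the limit of the main parts (Tannery)
  have hmain : Tendsto (fun p => ∑' k, mainPart δ f B m k p) l
      (𝓝 (iteratedFDerivWithin ℝ m f (slab δ B) (0, x₀))) := by
    have hid := (hasSum_coeff_smul_compContinuousLinearMap_scale
      (iteratedFDerivWithin ℝ m f (slab δ B) (0, x₀))).tsum_eq
    rw [← hid]
    refine tendsto_tsum_of_dominated_convergence (summable_abs_coeff_mul_pow_mul m N)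
      (fun k => ?_) ?_
    · -- pointwise convergence of the `k`-th main part
      have hw : Tendsto (fun p : ℝ × E' => weight δ k p.1) l (𝓝 (coeff k)) := by
        have h0 : weight δ k 0 = coeff k := weight_eq_coeff (by norm_num)
        rw [← h0]
        exact (((contDiff_weight δ k (n := 0)).continuous.comp continuous_fst).tendsto
          ((0 : ℝ), x₀)).mono_left nhdsWithin_le_nhds
      have hsc : Tendsto (fun p : ℝ × E' => scale k p) l (𝓝[slab δ B] ((0 : ℝ), x₀)) := by
        rw [tendsto_nhdsWithin_iff]
        constructor
        · have : scale k ((0 : ℝ), x₀) = ((0 : ℝ), x₀) := by simp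
          rw [← this]
          exact ((scale k).continuous.tendsto _).mono_left nhdsWithin_le_nhds
        · -- eventually `2^k t / δ > -1`
          have hI : Set.Ioi (-(δ / 2 ^ k)) ×ˢ (Set.univ : Set E') ∈ 𝓝 ((0 : ℝ), x₀) :=
            (isOpen_Ioi.prod isOpen_univ).mem_nhds ⟨by simp [hδ], Set.mem_univ _⟩
          filter_upwards [self_mem_nhdsWithin, mem_nhdsWithin_of_mem_nhds hI] with p hp hp'
          have hgt : -1 < 2 ^ k * p.1 / δ := by
            have h2 : (0 : ℝ) < 2 ^ k := by positivity
            have h3 : -(δ / 2 ^ k) < p.1 := hp'.1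
            have h4 : -δ < 2 ^ k * p.1 := by
              have := mul_lt_mul_of_pos_left h3 h2
              rwa [mul_neg, mul_div_cancel₀ _ h2.ne'] at this
            rw [lt_div_iff₀ hδ]; linarith
          exact Ioo_subset_slab (scale_mem_Ioo hδ hp.1 hp.2 hgt)
      have hD : Tendsto (fun p => iteratedFDerivWithin ℝ m f (slab δ B) (scale k p)) l
          (𝓝 (iteratedFDerivWithin ℝ m f (slab δ B) (0, x₀))) := by
        have hc : ContinuousWithinAt (iteratedFDerivWithin ℝ m f (slab δ B)) (slab δ B) (0, x₀) :=
          hf.continuousOn_iteratedFDerivWithin (by exact_mod_cast le_top) (uniqueDiffOn_slab hB)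
            (0, x₀) ⟨⟨le_rfl, hδ⟩, hx₀⟩
        exact hc.tendsto.comp hsc
      have hcomp := ((ContinuousMultilinearMap.continuous_precomp (F := F)
        (fun _ : Fin m => (scale k : ℝ × E' →L[ℝ] ℝ × E'))).tendsto _).comp hD
      have := hw.smul hcomp
      simpa [mainPart] using this
    · filter_upwards [hev] with p hp k
      exact norm_mainPart_le (f := f) (B := B) (δ := δ) hN0 fun h =>
        hN m le_rfl _ (Ioo_subset_slab (scale_mem_Ioo hδ hp.1.1 hp.1.2 (by linarith)))
          (scale_fst_le_of_weight_ne_zero hδ h) (by simpa using hp.2)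
  -- the remainders tend to zero (Tannery)
  have hrem : Tendsto (fun p => ∑' k, remainder δ f B m k p) l (𝓝 0) := by
    suffices h : Tendsto (fun p => ∑' k, remainder δ f B m k p) l
        (𝓝 (∑' _ : ℕ, (0 : ContinuousMultilinearMap ℝ (fun _ : Fin m => ℝ × E') F))) by
      rwa [tsum_zero] at h
    refine tendsto_tsum_of_dominated_convergence
      (summable_abs_coeff_mul_pow_mul m (N * (leibnizConst δ m + 1))) (fun k => ?_) ?_
    · -- eventually the `k`-th remainder vanishes
      have hI : Set.Ioi (-(δ / (4 * 2 ^ k))) ×ˢ (Set.univ : Set E') ∈ 𝓝 ((0 : ℝ), x₀) :=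
        (isOpen_Ioi.prod isOpen_univ).mem_nhds ⟨by simp [hδ], Set.mem_univ _⟩
      refine tendsto_const_nhds.congr' ?_
      filter_upwards [self_mem_nhdsWithin, mem_nhdsWithin_of_mem_nhds hI] with p hp hp'
      refine (remainder_eq_zero hδ hB hf hp.1 hp.2 (Or.inr ?_) m).symm
      have h2 : (0 : ℝ) < 4 * 2 ^ k := by positivity
      have h3 : -(δ / (4 * 2 ^ k)) < p.1 := hp'.1
      have h4 : -δ < 4 * 2 ^ k * p.1 := by
        have := mul_lt_mul_of_pos_left h3 h2
        rwa [mul_neg, mul_div_cancel₀ _ h2.ne'] at this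
      rw [lt_div_iff₀ hδ]; linarith
    · filter_upwards [hev] with p hp k
      have := norm_remainder_le hδ hB hf hN0 hN (k := k) hp.1.1 hp.1.2 hp.2 (m := m)
      calc ‖remainder δ f B m k p‖ ≤ |coeff k| * (2 ^ k) ^ m * N * (leibnizConst δ m + 1) := this
        _ = |coeff k| * (2 ^ k) ^ m * (N * (leibnizConst δ m + 1)) := by ring
  -- conclusion
  have hsum := hmain.add hrem
  rw [add_zero] at hsum
  refine hsum.congr' ?_
  filter_upwards [self_mem_nhdsWithin] with p hp
  exact (hdecomp p hp).symm

end Limit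

/-! ### Gluing jets across the hyperplane -/

section Union

variable {E' F : Type*} [NormedAddCommGroup E'] [NormedSpace ℝ E'] [NormedAddCommGroup F]
  [NormedSpace ℝ F]

/-- The upper part `O ∩ {t ≥ 0}` of an open set. [folklore] -/
def upper (O : Set (ℝ × E')) : Set (ℝ × E') := O ∩ {p | 0 ≤ p.1}

/-- The (open) lower part `O ∩ {t < 0}` of an open set. [folklore] -/
def lower (O : Set (ℝ × E')) : Set (ℝ × E') := O ∩ {p | p.1 < 0}

omit [NormedSpace ℝ E'] in
/-- The lower part of an open set is open. [folklore] -/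
theorem isOpen_lower {O : Set (ℝ × E')} (hO : IsOpen O) : IsOpen (lower O) :=
  hO.inter (isOpen_lt continuous_fst continuous_const)

/-- **Gluing jets across a hyperplane.** Let `O` be open in `ℝ × E'` and `g` be `C^∞` on the closed
upper part `O ∩ {t ≥ 0}` (within, with unique derivatives there) and on the open lower part
`O ∩ {t < 0}`. If for every `m` the `m`-th derivative of `g` within the lower part tends, at each
point of the hyperplane `O ∩ {t = 0}`, to the `m`-th derivative of `g` within the upper part,
then `g` is `C^∞` on `O`. (The formal Taylor series glued from the two one-sided series is a
Taylor series on `O`: on the hyperplane, the one-sided derivative from below exists and equals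
the limit, by the mean value inequality — Mathlib's `hasFDerivWithinAt_closure_of_tendsto_fderiv`.) [folklore] -/
theorem contDiffOn_of_tendsto_iteratedFDerivWithin {g : ℝ × E' → F} {O : Set (ℝ × E')}
    (hO : IsOpen O) (hU : UniqueDiffOn ℝ (upper O))
    (hup : ContDiffOn ℝ ∞ g (upper O)) (hlo : ContDiffOn ℝ ∞ g (lower O))
    (hlim : ∀ (m : ℕ), ∀ x ∈ O, x.1 = 0 →
      Tendsto (iteratedFDerivWithin ℝ m g (lower O)) (𝓝[lower O] x)
        (𝓝 (iteratedFDerivWithin ℝ m g (upper O) x))) :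
    ContDiffOn ℝ ∞ g O := by
  have hLo : IsOpen (lower O) := isOpen_lower hO
  have hUL : UniqueDiffOn ℝ (lower O) := hLo.uniqueDiffOn
  -- the two one-sided Taylor series
  set Pu := ftaylorSeriesWithin ℝ g (upper O) with hPudef
  set Pl := ftaylorSeriesWithin ℝ g (lower O) with hPldef
  have hSu : HasFTaylorSeriesUpToOn ∞ g Pu (upper O) := hup.ftaylorSeriesWithin hU
  have hSl : HasFTaylorSeriesUpToOn ∞ g Pl (lower O) := hlo.ftaylorSeriesWithin hUL
  have hlt : ∀ k : ℕ, (k : ℕ∞ω) < ∞ := fun k => WithTop.coe_lt_coe.2 (ENat.coe_lt_top k)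
  have hle : ∀ k : ℕ, (k : ℕ∞ω) ≤ ∞ := fun k => (hlt k).le
  -- the glued series
  set P : ℝ × E' → FormalMultilinearSeries ℝ (ℝ × E') F :=
    fun x => if 0 ≤ x.1 then Pu x else Pl x with hP
  have hPu : ∀ x : ℝ × E', 0 ≤ x.1 → P x = Pu x := fun x hx => if_pos hx
  have hPl : ∀ x : ℝ × E', x.1 < 0 → P x = Pl x := fun x hx => if_neg (not_le.2 hx)
  -- `Pl m` tends to `Pu m` at hyperplane points, from below
  have hlim' : ∀ (m : ℕ), ∀ x ∈ O, x.1 = 0 →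
      Tendsto (fun y => Pl y m) (𝓝[lower O] x) (𝓝 (Pu x m)) := fun m x hx h0 => hlim m x hx h0
  -- neighbourhood facts
  have hpos_nhds : ∀ x : ℝ × E', 0 < x.1 → {y : ℝ × E' | 0 < y.1} ∈ 𝓝 x := fun x hx =>
    (isOpen_lt continuous_const continuous_fst).mem_nhds hx
  have hneg_nhds : ∀ x : ℝ × E', x.1 < 0 → {y : ℝ × E' | y.1 < 0} ∈ 𝓝 x := fun x hx =>
    (isOpen_lt continuous_fst continuous_const).mem_nhds hx
  -- continuity of the one-sided series
  have hcu : ∀ k : ℕ, ContinuousOn (fun y => Pu y k) (upper O) := fun k => hSu.cont k (hle k)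
  have hcl : ∀ k : ℕ, ContinuousOn (fun y => Pl y k) (lower O) := fun k => hSl.cont k (hle k)
  rw [contDiffOn_infty]
  intro m
  refine HasFTaylorSeriesUpToOn.contDiffOn (f' := P) ⟨?_, ?_, ?_⟩
  · -- zero_eq
    intro x hx
    by_cases h0 : 0 ≤ x.1
    · rw [hPu x h0]; exact hSu.zero_eq x ⟨hx, h0⟩
    · rw [hPl x (not_le.1 h0)]; exact hSl.zero_eq x ⟨hx, not_le.1 h0⟩
  · -- fderivWithin
    intro k _ x hx
    rcases lt_trichotomy x.1 0 with hx1 | hx1 | hx1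
    · -- below: the lower series
      have h1 : HasFDerivWithinAt (fun y => Pl y k) (Pl x (k + 1)).curryLeft (lower O) x :=
        hSl.fderivWithin k (hlt k) x ⟨hx, hx1⟩
      rw [hPl x hx1]
      have h2 : HasFDerivWithinAt (fun y => Pl y k) (Pl x (k + 1)).curryLeft O x := by
        rw [← hasFDerivWithinAt_inter (hneg_nhds x hx1)]; exact h1
      refine h2.congr_of_eventuallyEq ?_ (by rw [hPl x hx1])
      filter_upwards [mem_nhdsWithin_of_mem_nhds (hneg_nhds x hx1)] with y hy
      rw [hPl y hy]
    · -- on the hyperplane: union of the two sides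
      rw [hPu x hx1.ge]
      have hOeq : O = upper O ∪ (O ∩ {p | p.1 ≤ 0}) := by
        ext y; simp only [upper, Set.mem_union, Set.mem_inter_iff, Set.mem_setOf_eq]
        constructor
        · intro hy; rcases le_total 0 y.1 with h | h
          · exact Or.inl ⟨hy, h⟩
          · exact Or.inr ⟨hy, h⟩
        · rintro (⟨hy, -⟩ | ⟨hy, -⟩) <;> exact hy
      rw [hOeq]
      refine HasFDerivWithinAt.union ?_ ?_
      · -- within the upper part: the upper series
        have h1 : HasFDerivWithinAt (fun y => Pu y k) (Pu x (k + 1)).curryLeft (upper O) x :=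
          hSu.fderivWithin k (hlt k) x ⟨hx, hx1.ge⟩
        refine h1.congr (fun y hy => ?_) (by rw [hPu x hx1.ge])
        rw [hPu y hy.2]
      · -- within the closed lower part: limit of the derivatives from below
        obtain ⟨r, hr, hball⟩ := Metric.isOpen_iff.1 hO x hx
        -- a small convex open piece of the lower part whose closure stays in `O`
        set s : Set (ℝ × E') := {p | p.1 < 0} ∩ Metric.ball x (r / 2) with hs
        have hs_open : IsOpen s := (isOpen_lt continuous_fst continuous_const).inter Metric.isOpen_ball
        have hs_conv : Convex ℝ s :=
          (convex_halfSpace_lt (LinearMap.fst ℝ ℝ E').isLinear 0).inter (convex_ball x (r / 2))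
        have hs_sub : s ⊆ lower O := fun y hy =>
          ⟨hball (Metric.ball_subset_ball (by linarith) hy.2), hy.1⟩
        have hcl_sub : closure s ⊆ O ∩ {p | p.1 ≤ 0} := by
          intro y hy
          have h1 : y ∈ closure (Metric.ball x (r / 2)) := closure_mono Set.inter_subset_right hy
          have h2 : y ∈ closure {p : ℝ × E' | p.1 < 0} := closure_mono Set.inter_subset_left hy
          have h3 : y.1 ≤ 0 := closure_lt_subset_le continuous_fst continuous_const h2
          refine ⟨hball ?_, h3⟩
          have : dist y x ≤ r / 2 := by
            rw [closure_ball x (by linarith)] at h1; exact h1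
          exact Metric.mem_ball.2 (lt_of_le_of_lt this (by linarith))
        -- the function `y ↦ P y k` on `s` and its derivative
        have hF_eq : ∀ y ∈ s, P y k = Pl y k := fun y hy => by rw [hPl y hy.1]
        have hderl : ∀ y ∈ s, HasFDerivAt (fun z => P z k) (Pl y (k + 1)).curryLeft y := by
          intro y hy
          have h1 : HasFDerivWithinAt (fun z => Pl z k) (Pl y (k + 1)).curryLeft (lower O) y :=
            hSl.fderivWithin k (hlt k) y (hs_sub hy)
          have h2 : HasFDerivAt (fun z => Pl z k) (Pl y (k + 1)).curryLeft y :=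
            h1.hasFDerivAt (hLo.mem_nhds (hs_sub hy))
          refine h2.congr_of_eventuallyEq ?_
          filter_upwards [hneg_nhds y hy.1] with z hz
          rw [hPl z hz]
        have hdiff : DifferentiableOn ℝ (fun z => P z k) s := fun y hy =>
          (hderl y hy).differentiableAt.differentiableWithinAt
        have hcont : ∀ y ∈ closure s, ContinuousWithinAt (fun z => P z k) s y := by
          intro y hy
          obtain ⟨hyO, hy0⟩ := hcl_sub hy
          rcases (show y.1 ≤ 0 from hy0).lt_or_eq with hy1 | hy1
          · -- interior point of the lower part
            have hc : ContinuousAt (fun z => Pl z k) y :=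
              (hcl k y ⟨hyO, hy1⟩).continuousAt (hLo.mem_nhds ⟨hyO, hy1⟩)
            have hc' : ContinuousAt (fun z => P z k) y := by
              refine hc.congr ?_
              filter_upwards [hneg_nhds y hy1] with z hz
              rw [hPl z hz]
            exact hc'.continuousWithinAt
          · -- hyperplane point: the limit hypothesis
            have h1 := (hlim' k y hyO hy1).mono_left (nhdsWithin_mono y hs_sub)
            have h2 : Tendsto (fun z => P z k) (𝓝[s] y) (𝓝 (Pu y k)) :=
              h1.congr' (eventually_nhdsWithin_of_forall fun z hz => (hF_eq z hz).symm)
            rw [ContinuousWithinAt, hPu y hy1.ge]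
            exact h2
        have hder_lim : Tendsto (fun y => fderiv ℝ (fun z => P z k) y) (𝓝[s] x)
            (𝓝 (Pu x (k + 1)).curryLeft) := by
          have h1 := (hlim' (k + 1) x hx hx1).mono_left (nhdsWithin_mono x hs_sub)
          have h2 : Tendsto (fun y => (Pl y (k + 1)).curryLeft) (𝓝[s] x)
              (𝓝 (Pu x (k + 1)).curryLeft) :=
            ((continuousMultilinearCurryLeftEquiv ℝ (fun _ : Fin (k + 1) => ℝ × E') F).continuous.tendsto
              _).comp h1
          refine h2.congr' (eventually_nhdsWithin_of_forall fun y hy => ?_)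
          exact ((hderl y hy).fderiv).symm
        have hcl_deriv := hasFDerivWithinAt_closure_of_tendsto_fderiv hdiff hs_conv hs_open hcont
          hder_lim
        -- the closed lower part near `x` lies in the closure of `s`
        have hsub_cl : O ∩ {p | p.1 ≤ 0} ∩ Metric.ball x (r / 2) ⊆ closure s := by
          rintro y ⟨⟨-, hy0⟩, hyb⟩
          rcases (show y.1 ≤ 0 from hy0).lt_or_eq with hy1 | hy1
          · exact subset_closure ⟨hy1, hyb⟩
          · -- approach `y` from below along the normal line
            rw [Metric.mem_closure_iff]
            intro ε hε
            obtain ⟨η, hη, hηε, hηb⟩ : ∃ η : ℝ, 0 < η ∧ η < ε ∧ dist y x + η < r / 2 := by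
              have hgap : 0 < r / 2 - dist y x := by linarith [Metric.mem_ball.1 hyb]
              refine ⟨min (ε / 2) ((r / 2 - dist y x) / 2), ?_, ?_, ?_⟩
              · positivity
              · exact lt_of_le_of_lt (min_le_left _ _) (by linarith)
              · have := min_le_right (ε / 2) ((r / 2 - dist y x) / 2); linarith
            refine ⟨(y.1 - η, y.2), ⟨?_, ?_⟩, ?_⟩
            · show y.1 - η < 0; linarith
            · rw [Metric.mem_ball]
              calc dist (y.1 - η, y.2) x ≤ dist (y.1 - η, y.2) y + dist y x := dist_triangle _ _ _
                _ = η + dist y x := by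
                    rw [Prod.dist_eq, dist_self, Real.dist_eq]
                    simp [abs_of_pos hη, hη.le]
                _ < r / 2 := by linarith
            · rw [Prod.dist_eq, dist_self, Real.dist_eq]
              simp [abs_of_pos hη, hηε, hη.le]
        have h3 : HasFDerivWithinAt (fun z => P z k) (Pu x (k + 1)).curryLeft
            (O ∩ {p | p.1 ≤ 0} ∩ Metric.ball x (r / 2)) x := hcl_deriv.mono hsub_cl
        rwa [hasFDerivWithinAt_inter (Metric.ball_mem_nhds x (by linarith))] at h3
    · -- above: the upper series on the open upper part
      have h1 : HasFDerivWithinAt (fun y => Pu y k) (Pu x (k + 1)).curryLeft (upper O) x :=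
        hSu.fderivWithin k (hlt k) x ⟨hx, hx1.le⟩
      rw [hPu x hx1.le]
      have h2 : HasFDerivWithinAt (fun y => Pu y k) (Pu x (k + 1)).curryLeft O x := by
        rw [← hasFDerivWithinAt_inter (hpos_nhds x hx1)]
        exact h1.mono fun y hy => ⟨hy.1, show 0 ≤ y.1 from le_of_lt hy.2⟩
      refine h2.congr_of_eventuallyEq ?_ (by rw [hPu x hx1.le])
      filter_upwards [mem_nhdsWithin_of_mem_nhds (hpos_nhds x hx1)] with y hy
      rw [hPu y (le_of_lt hy)]
  · -- cont
    intro k _ x hx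
    rcases lt_trichotomy x.1 0 with hx1 | hx1 | hx1
    · have hc : ContinuousAt (fun z => Pl z k) x :=
        (hcl k x ⟨hx, hx1⟩).continuousAt (hLo.mem_nhds ⟨hx, hx1⟩)
      refine (hc.congr ?_).continuousWithinAt
      filter_upwards [hneg_nhds x hx1] with z hz
      rw [hPl z hz]
    · -- hyperplane point: `O = upper ∪ lower`
      have hOeq : O = upper O ∪ lower O := by
        ext y; simp only [upper, lower, Set.mem_union, Set.mem_inter_iff, Set.mem_setOf_eq]
        constructor
        · intro hy; rcases le_or_gt 0 y.1 with h | h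
          · exact Or.inl ⟨hy, h⟩
          · exact Or.inr ⟨hy, h⟩
        · rintro (⟨hy, -⟩ | ⟨hy, -⟩) <;> exact hy
      rw [ContinuousWithinAt, hOeq, nhdsWithin_union, hPu x hx1.ge]
      refine Tendsto.sup ?_ ?_
      · exact ((hcu k x ⟨hx, hx1.ge⟩).tendsto).congr'
          (eventually_nhdsWithin_of_forall fun y hy => by show Pu y k = P y k; rw [hPu y hy.2])
      · exact (hlim' k x hx hx1).congr'
          (eventually_nhdsWithin_of_forall fun y hy => by show Pl y k = P y k; rw [hPl y hy.2])
    · have hup' : {y : ℝ × E' | 0 < y.1} ∩ O ⊆ upper O := fun y hy =>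
        ⟨hy.2, show 0 ≤ y.1 from le_of_lt hy.1⟩
      have hc : ContinuousWithinAt (fun z => Pu z k) (upper O) x := hcu k x ⟨hx, hx1.le⟩
      have hc' : ContinuousWithinAt (fun z => Pu z k) O x := by
        have := hc.mono_of_mem_nhdsWithin (Filter.mem_of_superset
          (Filter.inter_mem (mem_nhdsWithin_of_mem_nhds (hpos_nhds x hx1)) self_mem_nhdsWithin) hup')
        exact this
      rw [ContinuousWithinAt, hPu x hx1.le]
      exact hc'.tendsto.congr' (by
        filter_upwards [mem_nhdsWithin_of_mem_nhds (hpos_nhds x hx1)] with y hy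
        show Pu y k = P y k
        rw [hPu y (le_of_lt hy)])

end Union

/-! ### Seeley's theorem -/

section Main

variable {E' F : Type*} [NormedAddCommGroup E'] [NormedSpace ℝ E'] [NormedAddCommGroup F]
  [NormedSpace ℝ F] [CompleteSpace F]

omit [NormedAddCommGroup E'] [NormedSpace ℝ E'] in
/-- The upper part of `(-∞, δ) × B` is the slab `[0, δ) × B`. [folklore] -/
theorem upper_Iio_prod {E' : Type*} {δ : ℝ} (B : Set E') : upper (Set.Iio δ ×ˢ B) = slab δ B := by
  ext ⟨t, x⟩
  simp only [upper, slab, Set.mem_inter_iff, Set.mem_prod, Set.mem_Iio, Set.mem_setOf_eq, Set.mem_Ico]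
  tauto

omit [NormedAddCommGroup E'] [NormedSpace ℝ E'] in
/-- The lower part of `(-∞, δ) × B` is `(-∞, 0) × B` (`δ > 0`). [folklore] -/
theorem lower_Iio_prod {E' : Type*} {δ : ℝ} (hδ : 0 < δ) (B : Set E') :
    lower (Set.Iio δ ×ˢ B) = Set.Iio 0 ×ˢ B := by
  ext ⟨t, x⟩
  simp only [lower, Set.mem_inter_iff, Set.mem_prod, Set.mem_Iio, Set.mem_setOf_eq]
  constructor
  · rintro ⟨⟨-, hx⟩, ht⟩; exact ⟨ht, hx⟩
  · rintro ⟨ht, hx⟩; exact ⟨⟨by linarith, hx⟩, ht⟩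

/-- **Seeley's extension theorem** (R. T. Seeley, *Extension of `C^∞` functions defined in a half
space*, Proc. Amer. Math. Soc. 15 (1964), 625–626), local form: if `f` is `C^∞` on the slab
`[0, δ) × B` (`B` open) in the sense of derivatives within the slab, then Seeley's extension
`E f (t, x) = ∑_k a_k φ(2^k t/δ) f(-2^k t, x)` (`t < 0`), `E f = f` (`t ≥ 0`), is `C^∞` on the open
set `(-∞, δ) × B`. [folklore] -/
theorem contDiffOn_extend {δ : ℝ} (hδ : 0 < δ) {f : ℝ × E' → F} {B : Set E'} (hB : IsOpen B)
    (hf : ContDiffOn ℝ ∞ f (slab δ B)) : ContDiffOn ℝ ∞ (extend δ f) (Set.Iio δ ×ˢ B) := by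
  have hO : IsOpen (Set.Iio δ ×ˢ B) := isOpen_Iio.prod hB
  have heq : Set.EqOn (extend δ f) f (slab δ B) := fun p hp => extend_of_nonneg hp.1.1
  refine contDiffOn_of_tendsto_iteratedFDerivWithin hO ?_ ?_ ?_ ?_
  · rw [upper_Iio_prod]; exact uniqueDiffOn_slab hB
  · rw [upper_Iio_prod]; exact hf.congr heq
  · rw [lower_Iio_prod hδ]
    exact contDiffOn_extend_of_neg hδ hB (hf.mono Ioo_subset_slab)
  · intro m x hx hx0
    rw [lower_Iio_prod hδ, upper_Iio_prod]
    obtain ⟨t, x₀⟩ := x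
    simp only at hx0
    subst hx0
    have hx₀ : x₀ ∈ B := hx.2
    rw [iteratedFDerivWithin_congr heq ⟨⟨le_rfl, hδ⟩, hx₀⟩ m]
    exact tendsto_iteratedFDerivWithin_extend hδ hB hf hx₀ m

/-- **Extension of smooth functions across a boundary hyperplane, near a boundary point** (Seeley
1964): a function `C^∞` on `U ∩ {t ≥ 0}` (`U` open, derivatives within the closed half space)
agrees, near any boundary point `(0, x₀) ∈ U`, with a function `C^∞` on a full neighbourhood. [folklore] -/
theorem exists_contDiffOn_extension {f : ℝ × E' → F} {U : Set (ℝ × E')} (hU : IsOpen U) {x₀ : E'}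
    (h0 : ((0 : ℝ), x₀) ∈ U) (hf : ContDiffOn ℝ ∞ f (U ∩ {p | 0 ≤ p.1})) :
    ∃ V : Set (ℝ × E'), IsOpen V ∧ ((0 : ℝ), x₀) ∈ V ∧ V ⊆ U ∧
      ∃ g : ℝ × E' → F, ContDiffOn ℝ ∞ g V ∧ Set.EqOn g f (V ∩ {p | 0 ≤ p.1}) := by
  obtain ⟨δ, hδ, hball⟩ := Metric.isOpen_iff.1 hU _ h0
  set B : Set E' := Metric.ball x₀ δ with hB
  have hBo : IsOpen B := Metric.isOpen_ball
  have hsub : Set.Ioo (-δ) δ ×ˢ B ⊆ U := by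
    intro p hp
    apply hball
    rw [← ball_prod_same, Set.mem_prod]
    exact ⟨by simpa [Real.ball_eq_Ioo] using hp.1, hp.2⟩
  have hslab : slab δ B ⊆ U ∩ {p | 0 ≤ p.1} := fun p hp =>
    ⟨hsub ⟨⟨by linarith [hp.1.1], hp.1.2⟩, hp.2⟩, hp.1.1⟩
  refine ⟨Set.Ioo (-δ) δ ×ˢ B, isOpen_Ioo.prod hBo, ⟨⟨by linarith, hδ⟩, Metric.mem_ball_self hδ⟩,
    hsub, extend δ f, ?_, fun p hp => extend_of_nonneg hp.2⟩
  exact (contDiffOn_extend hδ hBo (hf.mono hslab)).mono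
    (Set.prod_mono Set.Ioo_subset_Iio_self le_rfl)

end Main

end Seeley

end Literature.Analysis.Calculus

end
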